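import Literature.NumberTheory.Sieve.LinearEquationsInPrimesNilObstruction
import Literature.NumberTheory.Sieve.LinearEquationsInPrimesWTrickExpSum
import Mathlib.NumberTheory.Chebyshev
import Mathlib.NumberTheory.ArithmeticFunction.VonMangoldt
import HarnessLib

/-!
# Linear equations in primes: the splitting `Λ = Λ♯ + Λ♭` and Prop. 10.2 from its two analytic
# inputs (Green–Tao 2010, §§11–12)

Trunk T-SIEVE (`Literature/NumberTheory/Sieve`), sixth file of the App. E / §11 programme in the
inline decomposition of the named fact `Literature.NumberTheory.Sieve.GreenTao2010_gowersUniformity`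
(B. Green, T. Tao, *Linear equations in primes*, Ann. of Math. 171 (2010), Thm. 7.2). After
`…NilObstruction.lean` (Cor. 11.6), Thm. 7.2 for `s ≥ 2` rested on `GI(s)`, Lemma E.9 and
Prop. 10.2 ("`W`-tricked `Λ'` orthogonal to nilsequences"). This file PROVES the reduction of
Prop. 10.2 carried out in §11 and in the first half of §12 of the paper: for a nilmanifold with
rational lower central series, Prop. 10.2 follows from the two analytic inputs of §12,

* (12.6) `‖(φ(W)/W) Λ♯(W · + b) - 1‖_{U^{s+1}[N]} = o_s(1)` — the Gowers-norm estimate for the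
  smooth piece `Λ♯` (proved in the paper in App. D from the Goldston–Yıldırım estimate Thm. D.3
  with exponents `a_i = 1`; here the predicate `GreenTao2010_sharpUniformAt s χ R`), and
* (12.7) `𝔼_{n ∈ [N]} (φ(W)/W) Λ♭(Wn + b) F(gⁿx) = o_{M,G/Γ,s}(1)` — the orthogonality of the rough
  piece `Λ♭` to bounded Lipschitz nilsequences (deduced in the paper, second half of §12, from the
  Möbius–nilsequences conjecture `MN(s)`, now the theorem of Green–Tao, Ann. of Math. 175 (2012);
  here the predicate `GreenTao2010_flatOrthogonalAt s X χ R`),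

for ANY cutoff `χ = χ♯` and level function `R = R(N)` (`R = N^{γ_s}` in the paper) with
`log R(N) ≠ 0` eventually; neither input is asserted in this file.

## Contents

* `vonMangoldtSmooth χ R n = -log R ∑_{d|n} μ(d) χ(log d/log R)` and the splitting (12.3)
  `Λ = Λ♯ + Λ♭` (`vonMangoldtSmooth_add_flat`, `flatCutoff χ = χ_id - χ`), its `W`-tricked form
  `vonMangoldtSmoothW`, `vonMangoldtFullW` (`Λ_{b,W}`), and the bridge to App. D,
  `Λ♯ = -Λ_{χ♯,R,1}` (`vonMangoldtSmooth_eq_neg_truncDivisorSum`, with the tree's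
  `Literature.NumberTheory.Sieve.truncDivisorSum`);
* the two elementary inputs of §12: the prime powers `∑_{n ≤ N} (Λ_{b,W} - Λ'_{b,W})(n) ≤
  ψ(x) - ϑ(x) ≤ 2√x log x = o(N)` in the `W`-trick range (`exists_sum_primePowers_le`, Mathlib's
  Chebyshev bounds), and `∑_{n ≤ N} |Λ'_{b,W}(n) - 1| ≤ 3N` (`exists_sum_abs_vonMangoldtW_sub_one_le`,
  the frequency-`0` case of `WTrick.wtrick_expSum_estimate`);
* the averaged nilsequence of Prop. 11.2 made explicit: window-averaged cube sums `cubeSum N f b`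
  (`shiftBox`, `windowWeight`; exactly `N^k` admissible shifts, `sum_windowWeight_eq`), the
  approximation step `abs_pow_mul_sum_sub_sum_cubeSum_le`, the trivial bound
  `abs_cubeSum_le_sum_abs`, the **dual-norm bound** `abs_cubeSum_le_uniformityNorm`
  (`|T_N(f;b)| ≤ (2(2k+1))^{k+1} N^{k+1} ‖f‖_{U^k[N]}`, the Gowers–Cauchy–Schwarz core of
  `…NilObstruction.lean` isolated as a lemma — display (11.2), "`‖F₁‖_{U^{s+1}[N]^*} ≪ 1`"), and
  the description of `T_N(f;b)` as a sum over shifts of interval correlations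
  (`cubeSum_eq_sum_window`, `windowLo`, `windowHi`) — "`F₁` is an averaged nilsequence";
* the Stone–Weierstrass step of Prop. 11.2 with bounded LIPSCHITZ factors and one common Lipschitz
  constant (`Nilmanifold.IsLip`, `Nilmanifold.cubeAlgebraLip`, `Nilmanifold.exists_cubeApprox_lip`;
  `…HostKraNilmanifold.lean` produced continuous factors, which suffice for Cor. 11.6 but not for
  (12.7), whose bound must be uniform in the Lipschitz constant);
* **`GreenTao2010_nilsequenceOrthogonalityAt_of_sharp_of_flat`** — Prop. 10.2 for a rational
  nilmanifold from (12.6) and (12.7); and the assemblies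
  `GreenTao2010_gowersUniformityAt_of_rationalDatum_of_sharp_of_flat`,
  `GreenTao2010_gowersUniformity_of_malcev_of_GI_of_sharp_of_flat`,
  `GreenTaoZiegler2012_finiteComplexity_of_malcev_of_GI_of_sharp_of_flat`: Thm. 7.2 (and the
  Green–Tao–Ziegler theorem) now rest on `GI(s)`, (12.6), (12.7) and Lemma E.9.

## The proof of Prop. 10.2 (as formalised; §11 and §12 of the paper)

Fix `X` rational, `M`, `ε`; `k = s + 1`. (1) A finite `ε/12`-net `(F_i)` of the Lipschitz class
and, for each `F_i`, a cube approximation `|F_i(g^m x) - ∑_α c_α ∏_ω B_{α,ω}(g^{m+ω·h}x)| ≤ ε/12`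
with `1`-bounded `K`-Lipschitz `B` (`K`, `L = ∑|c_α|` depending on `ε, M, X` only). (2) For the
weight `f = Λ'_{b,W} - 1`, average over the `N^k` window shifts:
`|N^k ∑_{n≤N} f(n)F(gⁿx) - ∑_α c_α T_N(f; b_α)| ≤ (ε/6) N^k ∑_{n≤N}|f(n)| ≤ (ε/2) N^{k+1}`. (3) Split
`f = (Λ'_{b,W} - Λ_{b,W}) + (Λ♯_{b,W} - 1) + Λ♭_{b,W}` inside each `T_N(f; b_α)` (linear in `f`):
the prime powers contribute `≤ N^k · o(N)` (trivial bound), the sharp piece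
`≤ (2(2k+1))^{k+1} N^{k+1} ‖Λ♯_{b,W} - 1‖_{U^k[N]}` (dual-norm bound and (12.6)), and the flat piece is
a sum over the `(2N)^k` shifts `h` of correlations of `Λ♭_{b,W}` over subintervals of `[N]` with the
product nilsequences `n ↦ ∏_{ω≠∅} B_{α,ω}(gⁿ (g^{ω·h}x))`, each `≤ o(N)` by (12.7). The paper
first decomposes `F = F₁ + F₂` (Prop. 11.2) and then treats `𝔼(Λ'_{b,W} - 1)F₁` (Prop. 11.3); the
window device of `…NilObstruction.lean` performs both steps at once, with `F₁` the average over
admissible shifts.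

## References

* B. Green, T. Tao, *Linear equations in primes*, Ann. of Math. (2) 171 (2010), 1753–1850
  (arXiv:math/0606088): §11 (Def. 11.1, Props. 11.2, 11.3 and the deduction of Prop. 10.2),
  §12 ((12.1)–(12.7)), App. D ("The correlation estimate for `Λ♯`"), (1.4).
* B. Green, T. Tao, *The Möbius function is strongly orthogonal to nilsequences*, Ann. of
  Math. (2) 175 (2012), 541–566, Thm. 1.1 (the `MN(s)` conjecture, Conj. 8.5 of the 2010 paper).
* B. Green, T. Tao, T. Ziegler, *An inverse theorem for the Gowers `U^{s+1}[N]`-norm*, Ann. of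
  Math. (2) 176 (2012), 1231–1372, Thm. 1.3.
-/

noncomputable section

open Finset Filter
open scoped BigOperators ArithmeticFunction.Moebius FourierTransform

namespace Literature.NumberTheory.Sieve

/-! ### The smooth splitting `Λ = Λ♯ + Λ♭` of the von Mangoldt function (§12) -/

/-- The smoothly weighted Möbius divisor sum
`Λ_χ(n) := -log R ∑_{d | n} μ(d) χ(log d / log R)` over ALL divisors of `n` ("Observe from (1.4) that
`Λ(n) = -log R ∑_{d|n} μ(d) χ(log d/log R)` where `χ(x) := x`"; with `χ = χ♯` this is `Λ♯`, with
`χ = χ♭` it is `Λ♭`, display (12.3)). [cite: GreenTao2010, §12, (12.3)] -/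
def vonMangoldtSmooth (χ : ℝ → ℝ) (R : ℝ) (n : ℕ) : ℝ :=
  -Real.log R * ∑ d ∈ n.divisors, (ArithmeticFunction.moebius d : ℝ) * χ (Real.log d / Real.log R)

/-- The complementary ("rough") cutoff `χ♭ := χ - χ♯` of a cutoff `χ♯`, where `χ(x) = x` ("We now
perform a smooth splitting `χ = χ♯ + χ♭`"). [cite: GreenTao2010, §12, before (12.3)] -/
def flatCutoff (χ : ℝ → ℝ) (x : ℝ) : ℝ := x - χ x

/-- `Λ_χ(0) = 0` (no divisors are summed). [folklore] -/
@[simp] theorem vonMangoldtSmooth_zero (χ : ℝ → ℝ) (R : ℝ) : vonMangoldtSmooth χ R 0 = 0 := by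
  simp [vonMangoldtSmooth]

/-- **`Λ = -log R ∑_{d|n} μ(d) χ(log d/log R)` for the identity cutoff `χ(x) = x`** (display (1.4),
`Λ(n) = -∑_{d|n} μ(d) log d`), whenever `log R ≠ 0`. [cite: GreenTao2010, §12 and (1.4)] -/
theorem vonMangoldtSmooth_id {R : ℝ} (hR : Real.log R ≠ 0) (n : ℕ) :
    vonMangoldtSmooth (fun x => x) R n = ArithmeticFunction.vonMangoldt n := by
  unfold vonMangoldtSmooth
  have h1 : ∑ d ∈ n.divisors, (ArithmeticFunction.moebius d : ℝ) * (Real.log d / Real.log R) =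
      (∑ d ∈ n.divisors, (ArithmeticFunction.moebius d : ℝ) * Real.log d) / Real.log R := by
    rw [Finset.sum_div]
    exact Finset.sum_congr rfl fun d _ => by ring
  have h2 := ArithmeticFunction.sum_moebius_mul_log_eq (n := n)
  simp only [ArithmeticFunction.log_apply] at h2
  rw [h1, h2]
  field_simp

/-- Additivity of `Λ_χ` in the cutoff. [folklore] -/
theorem vonMangoldtSmooth_add (χ₁ χ₂ : ℝ → ℝ) (R : ℝ) (n : ℕ) :
    vonMangoldtSmooth (fun x => χ₁ x + χ₂ x) R n =
      vonMangoldtSmooth χ₁ R n + vonMangoldtSmooth χ₂ R n := by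
  unfold vonMangoldtSmooth
  rw [← mul_add, ← Finset.sum_add_distrib]
  congr 1
  exact Finset.sum_congr rfl fun d _ => by ring

/-- **The splitting `Λ = Λ♯ + Λ♭`** induced by `χ = χ♯ + χ♭` (display (12.3)), for any cutoff `χ♯`
and any level `R` with `log R ≠ 0`. [cite: GreenTao2010, §12, (12.3)] -/
theorem vonMangoldtSmooth_add_flat {R : ℝ} (hR : Real.log R ≠ 0) (χ : ℝ → ℝ) (n : ℕ) :
    vonMangoldtSmooth χ R n + vonMangoldtSmooth (flatCutoff χ) R n =
      ArithmeticFunction.vonMangoldt n := by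
  rw [← vonMangoldtSmooth_add, ← vonMangoldtSmooth_id hR n]
  unfold vonMangoldtSmooth flatCutoff
  congr 1
  exact Finset.sum_congr rfl fun d _ => by ring

/-- For a cutoff vanishing on `[1, ∞)` and a level `R > 1`, `Λ_{χ}` is minus the truncated divisor
sum `Λ_{χ,R,1}` of App. D ("Now observe that `Λ♯ = -Λ_{χ♯,R,1}`"): only divisors `d ≤ R` enter.
[cite: GreenTao2010, App. D, proof of (12.6) (p. 1834)] -/
theorem vonMangoldtSmooth_eq_neg_truncDivisorSum {χ : ℝ → ℝ} (hχ : ∀ x, 1 ≤ x → χ x = 0) {R : ℝ}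
    (hR : 1 < R) {n : ℕ} (hn : n ≠ 0) :
    vonMangoldtSmooth χ R n = -truncDivisorSum χ R 1 n := by
  classical
  unfold vonMangoldtSmooth truncDivisorSum moebiusDivisorSum
  rw [pow_one, neg_mul]
  congr 2
  have hlogR : 0 < Real.log R := Real.log_pos hR
  -- the two index sets differ by divisors `d > ⌊R⌋`, where `χ` vanishes
  have hsub : (Finset.Icc 1 ⌊R⌋₊).filter (fun e : ℕ => (e : ℤ) ∣ (n : ℤ)) ⊆ n.divisors := by
    intro e he
    rw [Finset.mem_filter, Finset.mem_Icc] at he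
    exact Nat.mem_divisors.mpr ⟨Int.natCast_dvd_natCast.mp he.2, hn⟩
  symm
  refine Finset.sum_subset hsub fun d hd hd' => ?_
  have hdn := Nat.mem_divisors.mp hd
  have hd1 : 1 ≤ d := Nat.pos_of_ne_zero (ne_zero_of_dvd_ne_zero hdn.2 hdn.1)
  have hdR : ⌊R⌋₊ < d := by
    by_contra h
    push Not at h
    exact hd' (Finset.mem_filter.mpr ⟨Finset.mem_Icc.mpr ⟨hd1, h⟩,
      Int.natCast_dvd_natCast.mpr hdn.1⟩)
  have hRd : R < d := Nat.lt_of_floor_lt hdR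
  have h1 : 1 ≤ Real.log d / Real.log R := by
    rw [le_div_iff₀ hlogR, one_mul]
    exact Real.log_le_log (by linarith) hRd.le
  rw [hχ _ h1, mul_zero]

/-- The `W`-tricked smooth piece `Λ_{χ; b,W}(n) := (φ(W)/W) Λ_χ(Wn + b)` (with `χ = χ♯`, `χ♭` the
two functions of displays (12.4), (12.5)). [cite: GreenTao2010, §12, (12.4)–(12.5)] -/
def vonMangoldtSmoothW (χ : ℝ → ℝ) (R : ℝ) (W b n : ℕ) : ℝ :=
  (Nat.totient W : ℝ) / W * vonMangoldtSmooth χ R (W * n + b)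

/-- The `W`-tricked von Mangoldt function `Λ_{b,W}(n) = (φ(W)/W) Λ(Wn + b)` of display (12.2)
(un-primed: prime powers included). [cite: GreenTao2010, §12, (12.2) and (5.?) (definition of `Λ_{b,W}`)] -/
def vonMangoldtFullW (W b n : ℕ) : ℝ :=
  (Nat.totient W : ℝ) / W * ArithmeticFunction.vonMangoldt (W * n + b)

/-- `Λ_{b,W} = Λ♯_{b,W} + Λ♭_{b,W}`. [cite: GreenTao2010, §12, (12.3)–(12.5)] -/
theorem vonMangoldtSmoothW_add_flat {R : ℝ} (hR : Real.log R ≠ 0) (χ : ℝ → ℝ) (W b n : ℕ) :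
    vonMangoldtSmoothW χ R W b n + vonMangoldtSmoothW (flatCutoff χ) R W b n =
      vonMangoldtFullW W b n := by
  unfold vonMangoldtSmoothW vonMangoldtFullW
  rw [← mul_add, vonMangoldtSmooth_add_flat hR]

/-! ### The prime powers: `Λ_{b,W} - Λ'_{b,W}` is small in `L¹` -/

/-- `Λ - Λ' ≥ 0` is `Λ` restricted to the non-primes. [folklore] -/
theorem vonMangoldt_sub_vonMangoldtPrime (m : ℕ) :
    ArithmeticFunction.vonMangoldt m - vonMangoldtPrime m =
      if m.Prime then 0 else ArithmeticFunction.vonMangoldt m := by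
  unfold vonMangoldtPrime
  split_ifs with h
  · rw [ArithmeticFunction.vonMangoldt_apply_prime h, sub_self]
  · rw [sub_zero]

/-- **The prime powers are negligible** ("The contribution from the prime powers which are
introduced when `Λ'_{b,W}` is replaced by `Λ_{b,W}` is easily seen to be negligible"):
`∑_{n ∈ [N]} (Λ(Wn+b) - Λ'(Wn+b)) ≤ ψ(x) - ϑ(x) ≤ 2 √x log x`, `x = WN + b` (`b ≥ 1`).
[cite: GreenTao2010, §12, before (12.1)] -/
theorem sum_vonMangoldt_sub_prime_le {W b : ℕ} (hW : 1 ≤ W) (hb : 1 ≤ b) (N : ℕ) :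
    ∑ n ∈ Finset.Icc 1 N,
        (ArithmeticFunction.vonMangoldt (W * n + b) - vonMangoldtPrime (W * n + b)) ≤
      2 * Real.sqrt ((W * N + b : ℕ) : ℝ) * Real.log ((W * N + b : ℕ) : ℝ) := by
  set x : ℝ := ((W * N + b : ℕ) : ℝ) with hx
  have hx1 : (1 : ℝ) ≤ x := by
    rw [hx]; exact_mod_cast (show 1 ≤ W * N + b by omega)
  have hfloor : ⌊x⌋₊ = W * N + b := by rw [hx, Nat.floor_natCast]
  -- the map `n ↦ Wn + b` is injective from `[N]` into the non-primes' ambient range `(0, WN+b]`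
  set g : ℕ → ℝ := fun m => if m.Prime then 0 else ArithmeticFunction.vonMangoldt m with hg
  have hg0 : ∀ m, 0 ≤ g m := fun m => by
    simp only [hg]; split_ifs
    · exact le_rfl
    · exact ArithmeticFunction.vonMangoldt_nonneg
  have hinj : Set.InjOn (fun n : ℕ => W * n + b) (Finset.Icc 1 N : Set ℕ) := by
    intro n _ n' _ h
    have : W * n = W * n' := by simpa using h
    exact Nat.eq_of_mul_eq_mul_left (by omega) this
  calc ∑ n ∈ Finset.Icc 1 N,
        (ArithmeticFunction.vonMangoldt (W * n + b) - vonMangoldtPrime (W * n + b))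
      = ∑ n ∈ Finset.Icc 1 N, g (W * n + b) :=
        Finset.sum_congr rfl fun n _ => vonMangoldt_sub_vonMangoldtPrime _
    _ = ∑ m ∈ (Finset.Icc 1 N).image (fun n => W * n + b), g m := by
        rw [Finset.sum_image fun n hn n' hn' h => hinj hn hn' h]
    _ ≤ ∑ m ∈ Finset.Ioc 0 ⌊x⌋₊, g m := by
        refine Finset.sum_le_sum_of_subset_of_nonneg ?_ fun m _ _ => hg0 m
        intro m hm
        obtain ⟨n, hn, rfl⟩ := Finset.mem_image.mp hm
        rw [Finset.mem_Icc] at hn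
        rw [Finset.mem_Ioc, hfloor]
        exact ⟨by omega, Nat.add_le_add_right (Nat.mul_le_mul_left W hn.2) b⟩
    _ = ∑ m ∈ (Finset.Ioc 0 ⌊x⌋₊).filter (fun m => ¬ m.Prime), ArithmeticFunction.vonMangoldt m := by
        rw [Finset.sum_filter]
        refine Finset.sum_congr rfl fun m _ => ?_
        simp only [hg]
        split_ifs <;> rfl
    _ = Chebyshev.psi x - Chebyshev.theta x := (Chebyshev.psi_sub_theta_eq_sum_not_prime x).symm
    _ ≤ 2 * Real.sqrt x * Real.log x := Chebyshev.psi_sub_theta_le hx1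

/-- The `W`-tricked form: `∑_{n ∈ [N]} (Λ_{b,W}(n) - Λ'_{b,W}(n)) ≤ 2 √(WN+b) log(WN+b)` (using
`φ(W)/W ≤ 1`). [cite: GreenTao2010, §12, before (12.1)] -/
theorem sum_vonMangoldtFullW_sub_vonMangoldtW_le {W b : ℕ} (hW : 1 ≤ W) (hb : 1 ≤ b) (N : ℕ) :
    ∑ n ∈ Finset.Icc 1 N, (vonMangoldtFullW W b n - vonMangoldtW W b n) ≤
      2 * Real.sqrt ((W * N + b : ℕ) : ℝ) * Real.log ((W * N + b : ℕ) : ℝ) := by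
  have hφ : (Nat.totient W : ℝ) / W ≤ 1 := by
    rw [div_le_one (by exact_mod_cast (show 0 < W by omega))]
    exact_mod_cast Nat.totient_le W
  have hφ0 : 0 ≤ (Nat.totient W : ℝ) / W := by positivity
  calc ∑ n ∈ Finset.Icc 1 N, (vonMangoldtFullW W b n - vonMangoldtW W b n)
      = ∑ n ∈ Finset.Icc 1 N, (Nat.totient W : ℝ) / W *
          (ArithmeticFunction.vonMangoldt (W * n + b) - vonMangoldtPrime (W * n + b)) := by
        refine Finset.sum_congr rfl fun n _ => ?_
        unfold vonMangoldtFullW vonMangoldtW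
        ring
    _ ≤ ∑ n ∈ Finset.Icc 1 N,
          (ArithmeticFunction.vonMangoldt (W * n + b) - vonMangoldtPrime (W * n + b)) := by
        refine Finset.sum_le_sum fun n _ => ?_
        have h0 : 0 ≤ ArithmeticFunction.vonMangoldt (W * n + b) - vonMangoldtPrime (W * n + b) := by
          rw [vonMangoldt_sub_vonMangoldtPrime]
          split_ifs
          · exact le_rfl
          · exact ArithmeticFunction.vonMangoldt_nonneg
        calc (Nat.totient W : ℝ) / W *
              (ArithmeticFunction.vonMangoldt (W * n + b) - vonMangoldtPrime (W * n + b))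
            ≤ 1 * (ArithmeticFunction.vonMangoldt (W * n + b) - vonMangoldtPrime (W * n + b)) :=
              mul_le_mul_of_nonneg_right hφ h0
          _ = _ := one_mul _
    _ ≤ _ := sum_vonMangoldt_sub_prime_le hW hb N

/-- Pointwise, `Λ'_{b,W} ≤ Λ_{b,W}`. [folklore] -/
theorem vonMangoldtW_le_vonMangoldtFullW (W b n : ℕ) : vonMangoldtW W b n ≤ vonMangoldtFullW W b n := by
  unfold vonMangoldtFullW vonMangoldtW
  refine mul_le_mul_of_nonneg_left ?_ (by positivity)
  have := vonMangoldt_sub_vonMangoldtPrime (W * n + b)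
  have h0 : 0 ≤ ArithmeticFunction.vonMangoldt (W * n + b) - vonMangoldtPrime (W * n + b) := by
    rw [this]
    split_ifs
    · exact le_rfl
    · exact ArithmeticFunction.vonMangoldt_nonneg
  linarith

/-- **In the `W`-trick range the prime powers contribute `o(N)`**: for `ε > 0` there is `N₀` with
`∑_{n ∈ [N]} (Λ_{b,W}(n) - Λ'_{b,W}(n)) ≤ ε N` for all `N ≥ N₀`, `w ≤ ½ log log N`, `1 ≤ b ≤ W`
(as `W ≤ log N`, so `WN + b ≤ 2 N log N` and `2√x log x = O(√N log^{3/2} N)`).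
[cite: GreenTao2010, §12, before (12.1)] -/
theorem exists_sum_primePowers_le {ε : ℝ} (hε : 0 < ε) :
    ∃ N₀ : ℕ, ∀ N : ℕ, N₀ ≤ N → ∀ w : ℕ, (w : ℝ) ≤ Real.log (Real.log N) / 2 →
      ∀ b : ℕ, 1 ≤ b → b ≤ primorial w →
        ∑ n ∈ Finset.Icc 1 N, (vonMangoldtFullW (primorial w) b n - vonMangoldtW (primorial w) b n) ≤
          ε * N := by
  -- `8 (log N)^2 N^{1/2} ≤ ε N` eventually
  have hev := WTrick.eventually_nat_mul_log_pow_mul_rpow_le 8 2 (θ := 1 / 2) (by norm_num) hε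
  obtain ⟨N₁, hN₁⟩ := Filter.eventually_atTop.mp hev
  refine ⟨max N₁ 16, fun N hN w hw b hb1 hbW => ?_⟩
  have hN16 : 16 ≤ N := le_of_max_le_right hN
  have hNr : (16 : ℝ) ≤ N := by exact_mod_cast hN16
  have hN3 : (3 : ℝ) ≤ N := by linarith
  have hN0 : (0 : ℝ) < N := by linarith
  set W := primorial w with hWdef
  have hW1 : 1 ≤ W := Nat.one_le_iff_ne_zero.mpr (primorial_pos w).ne'
  have hWlog : (W : ℝ) ≤ Real.log N := WTrick.primorial_le_log hN3 hw
  have hlogN1 : 1 ≤ Real.log N := by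
    have h16 : (1 : ℝ) ≤ Real.log 16 := by
      rw [Real.le_log_iff_exp_le (by norm_num)]
      exact Real.exp_one_lt_d9.le.trans (by norm_num)
    exact h16.trans (Real.log_le_log (by norm_num) hNr)
  -- `x = WN + b ≤ 2 N log N ≤ N^2`
  set x : ℝ := ((W * N + b : ℕ) : ℝ) with hx
  have hxle : x ≤ 2 * N * Real.log N := by
    rw [hx]; push_cast
    have hb' : (b : ℝ) ≤ W := by exact_mod_cast hbW
    have h1 : (b : ℝ) ≤ Real.log N * N := by
      calc (b : ℝ) ≤ W := hb'
        _ ≤ Real.log N := hWlog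
        _ = Real.log N * 1 := (mul_one _).symm
        _ ≤ Real.log N * N := mul_le_mul_of_nonneg_left (by linarith) (by linarith)
    have h2 : (W : ℝ) * N ≤ Real.log N * N := mul_le_mul_of_nonneg_right hWlog hN0.le
    linarith
  have hx1 : (1 : ℝ) ≤ x := by rw [hx]; exact_mod_cast (show 1 ≤ W * N + b by omega)
  have hxN2 : x ≤ (N : ℝ) ^ 2 := by
    calc x ≤ 2 * N * Real.log N := hxle
      _ ≤ 2 * N * (N / 2) := by
          refine mul_le_mul_of_nonneg_left ?_ (by positivity)
          linarith [WTrick.two_mul_log_le hNr]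
      _ = (N : ℝ) ^ 2 := by ring
  have hlogx : Real.log x ≤ 2 * Real.log N := by
    calc Real.log x ≤ Real.log ((N : ℝ) ^ 2) := Real.log_le_log (by linarith) hxN2
      _ = 2 * Real.log N := by rw [Real.log_pow]; push_cast; ring
  have hlogx0 : 0 ≤ Real.log x := Real.log_nonneg hx1
  have hsqrtx : Real.sqrt x ≤ Real.sqrt 2 * Real.sqrt N * Real.sqrt (Real.log N) := by
    rw [← Real.sqrt_mul (by norm_num), ← Real.sqrt_mul (by positivity)]
    exact Real.sqrt_le_sqrt hxle
  -- the Chebyshev bound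
  have hcheb := sum_vonMangoldtFullW_sub_vonMangoldtW_le (W := W) hW1 hb1 N
  have hs2 : Real.sqrt 2 ≤ 2 := by
    have h := Real.sqrt_le_sqrt (show (2 : ℝ) ≤ 2 ^ 2 by norm_num)
    rwa [Real.sqrt_sq (by norm_num : (0 : ℝ) ≤ 2)] at h
  have hsl : Real.sqrt (Real.log N) ≤ Real.log N := by
    have h := Real.sqrt_le_sqrt (show Real.log N ≤ Real.log N ^ 2 by nlinarith)
    rwa [Real.sqrt_sq (by linarith : (0 : ℝ) ≤ Real.log N)] at h
  have hsqrtN : Real.sqrt N = (N : ℝ) ^ (1 / 2 : ℝ) := Real.sqrt_eq_rpow _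
  have h0N : 0 ≤ Real.sqrt (N : ℝ) := Real.sqrt_nonneg _
  have h0l : 0 ≤ Real.sqrt (Real.log N) := Real.sqrt_nonneg _
  have hmain : 2 * Real.sqrt x * Real.log x ≤ 8 * Real.log N ^ 2 * (N : ℝ) ^ (1 / 2 : ℝ) := by
    rw [← hsqrtN]
    have h1 : 2 * Real.sqrt x * Real.log x ≤
        2 * (Real.sqrt 2 * Real.sqrt N * Real.sqrt (Real.log N)) * Real.log x :=
      mul_le_mul_of_nonneg_right (mul_le_mul_of_nonneg_left hsqrtx (by norm_num)) hlogx0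
    have h2 : 2 * (Real.sqrt 2 * Real.sqrt N * Real.sqrt (Real.log N)) * Real.log x ≤
        2 * (Real.sqrt 2 * Real.sqrt N * Real.sqrt (Real.log N)) * (2 * Real.log N) :=
      mul_le_mul_of_nonneg_left hlogx (by positivity)
    have h3 : Real.sqrt 2 * Real.sqrt N * Real.sqrt (Real.log N) ≤ 2 * Real.sqrt N * Real.log N :=
      mul_le_mul (mul_le_mul_of_nonneg_right hs2 h0N) hsl h0l (by positivity)
    have h4 : 2 * (Real.sqrt 2 * Real.sqrt N * Real.sqrt (Real.log N)) * (2 * Real.log N) ≤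
        2 * (2 * Real.sqrt N * Real.log N) * (2 * Real.log N) :=
      mul_le_mul_of_nonneg_right (mul_le_mul_of_nonneg_left h3 (by norm_num)) (by linarith)
    calc 2 * Real.sqrt x * Real.log x
        ≤ 2 * (2 * Real.sqrt N * Real.log N) * (2 * Real.log N) := h1.trans (h2.trans h4)
      _ = 8 * Real.log N ^ 2 * Real.sqrt N := by ring
  calc _ ≤ 2 * Real.sqrt x * Real.log x := hcheb
    _ ≤ 8 * Real.log N ^ 2 * (N : ℝ) ^ (1 / 2 : ℝ) := hmain
    _ ≤ ε * N := hN₁ N (le_of_max_le_left hN)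

/-! ### `L¹` control of `Λ'_{b,W} - 1` -/

/-- **`∑_{n ∈ [N]} |Λ'_{b,W}(n) - 1| ≤ 3N` in the `W`-trick range** (`N ≥ N₀`, `w₀ ≤ w ≤ ½ log log N`,
`b ∈ [W]` coprime to `W`): from `|∑_{n ∈ [N]} (Λ'_{b,W}(n) - 1)| ≤ N`, the frequency-`0` case of the
exponential-sum estimate `WTrick.wtrick_expSum_estimate` (Siegel–Walfisz), and `Λ' ≥ 0` ("any
error which is small in `L¹` norm will be easily removed since the nilsequence is bounded";
`𝔼_{n ∈ [N]} Λ'_{b,W}(n) = 1 + o(1)` is (1.7)/(6.?) of the paper). [cite: GreenTao2010, §11 (before Def. 11.1)] -/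
theorem exists_sum_abs_vonMangoldtW_sub_one_le :
    ∃ w₀ N₀ : ℕ, ∀ N : ℕ, N₀ ≤ N → ∀ w : ℕ, w₀ ≤ w → (w : ℝ) ≤ Real.log (Real.log N) / 2 →
      ∀ b : ℕ, 1 ≤ b → b ≤ primorial w → Nat.Coprime b (primorial w) →
        ∑ n ∈ Finset.Icc 1 N, |vonMangoldtW (primorial w) b n - 1| ≤ 3 * N := by
  obtain ⟨w₀, N₀, h⟩ := WTrick.wtrick_expSum_estimate 1 one_pos
  refine ⟨w₀, N₀, fun N hN w hw hwlog b hb1 hbW hbcop => ?_⟩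
  have key := h N hN w hw hwlog b hb1 hbW hbcop 0
  have h0 : ∀ n : ℕ, ((𝐞 ((n : ℝ) * 0) : Circle) : ℂ) = 1 := fun n => by simp
  simp_rw [h0, mul_one] at key
  rw [← Complex.ofReal_sum, Complex.norm_real, Real.norm_eq_abs, one_mul] at key
  have h1 : ∑ n ∈ Finset.Icc 1 N, (vonMangoldtW (primorial w) b n - 1) ≤ N := (le_abs_self _).trans key
  have h2 : ∀ n, |vonMangoldtW (primorial w) b n - 1| ≤ (vonMangoldtW (primorial w) b n - 1) + 2 := by
    intro n
    have h0n := (vonMangoldtW_nonneg_le_log (primorial w) b n).1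
    rw [abs_le]
    constructor <;> linarith
  calc ∑ n ∈ Finset.Icc 1 N, |vonMangoldtW (primorial w) b n - 1|
      ≤ ∑ n ∈ Finset.Icc 1 N, ((vonMangoldtW (primorial w) b n - 1) + 2) := Finset.sum_le_sum fun n _ => h2 n
    _ = ∑ n ∈ Finset.Icc 1 N, (vonMangoldtW (primorial w) b n - 1) + 2 * N := by
        rw [Finset.sum_add_distrib, Finset.sum_const, Nat.card_Icc, nsmul_eq_mul]
        push_cast
        ring
    _ ≤ N + 2 * N := by linarith
    _ = 3 * N := by ring

/-! ### Window-averaged cube sums (the averaging device of the proof of Prop. 11.2, made explicit) -/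

section cubesum

variable {k : ℕ}

/-- The box `[1, 2N]^k` of shifts `h`. [cite: GreenTao2010, §11, proof of Prop. 11.2] -/
def shiftBox (k N : ℕ) : Finset (Fin k → ℤ) := Fintype.piFinset fun _ : Fin k => Icc (1 : ℤ) (2 * N)

/-- The window weight `w(n, h) = ∏_j 1_{[N+1, 2N]}(n + h_j)` (a vertex function at the vertices
`{j}` replacing the smooth cutoff `σ(h_1/N) ⋯ σ(h_{s+1}/N)` of the paper).
[cite: GreenTao2010, §11, proof of Prop. 11.2] -/
def windowWeight (N : ℕ) (n : ℤ) (h : Fin k → ℤ) : ℝ :=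
  ∏ j, if (N : ℤ) + 1 ≤ n + h j ∧ n + h j ≤ 2 * N then (1 : ℝ) else 0

/-- **The window-averaged cube sum**
`T_N(f; b) = ∑_{n ∈ [N]} ∑_{h ∈ [1,2N]^k} w(n,h) f(n) ∏_{ω ⊆ [k]} b_ω(n + ω·h)`: `N^k` times the
correlation of `f` with the "averaged" sequence `n ↦ N^{-k} ∑_h w(n,h) ∏_ω b_ω(n + ω·h)` (the
averaged nilsequence `F_1` of Prop. 11.2 when `b_ω(m) = H_ω(g^m x)`).
[cite: GreenTao2010, §11, Def. 11.1 and proof of Prop. 11.2] -/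
def cubeSum (N : ℕ) (f : ℤ → ℝ) (b : Finset (Fin k) → ℤ → ℝ) : ℝ :=
  ∑ p ∈ Icc (1 : ℤ) N ×ˢ shiftBox k N,
    windowWeight N p.1 p.2 * (f p.1 * ∏ ω : Finset (Fin k), b ω (p.1 + ∑ j ∈ ω, p.2 j))

/-- Membership in the shift box. [folklore] -/
theorem mem_shiftBox {N : ℕ} {h : Fin k → ℤ} : h ∈ shiftBox k N ↔ ∀ j, 1 ≤ h j ∧ h j ≤ 2 * N := by
  unfold shiftBox
  rw [Fintype.mem_piFinset]
  exact forall_congr' fun j => by rw [Finset.mem_Icc]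

/-- `#[1,2N]^k = (2N)^k`. [folklore] -/
theorem card_shiftBox (k N : ℕ) : (shiftBox k N).card = (2 * N) ^ k := by
  unfold shiftBox
  rw [Fintype.card_piFinset, Finset.prod_const, Finset.card_univ, Fintype.card_fin, Int.card_Icc]
  congr 1
  omega

/-- `w(n,h) ≥ 0`. [folklore] -/
theorem windowWeight_nonneg (N : ℕ) (n : ℤ) (h : Fin k → ℤ) : 0 ≤ windowWeight N n h :=
  Finset.prod_nonneg fun j _ => by split_ifs <;> norm_num

/-- `w(n,h) = 1` if all `n + h_j ∈ [N+1, 2N]`, else `0`. [folklore] -/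
theorem windowWeight_eq_ite (N : ℕ) (n : ℤ) (h : Fin k → ℤ) :
    windowWeight N n h = if ∀ j, (N : ℤ) + 1 ≤ n + h j ∧ n + h j ≤ 2 * N then 1 else 0 := by
  unfold windowWeight
  split_ifs with hall
  · exact Finset.prod_eq_one fun j _ => if_pos (hall j)
  · push Not at hall
    obtain ⟨j, hj⟩ := hall
    exact Finset.prod_eq_zero (Finset.mem_univ j) (if_neg fun h' => absurd h'.2 (not_le.mpr (hj h'.1)))

/-- `w(n,h) ≤ 1`. [folklore] -/
theorem windowWeight_le_one (N : ℕ) (n : ℤ) (h : Fin k → ℤ) : windowWeight N n h ≤ 1 := by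
  rw [windowWeight_eq_ite]; split_ifs <;> norm_num

/-- **Exactly `N^k` admissible shifts** for each `n ∈ [N]`: `∑_{h ∈ [1,2N]^k} w(n,h) = N^k`.
[cite: GreenTao2010, §11, proof of Prop. 11.2] -/
theorem sum_windowWeight_eq {N : ℕ} {n : ℤ} (hn1 : 1 ≤ n) (hnN : n ≤ N) :
    ∑ h ∈ shiftBox k N, windowWeight N n h = (N : ℝ) ^ k := by
  have h1 : ∑ t ∈ Icc (1 : ℤ) (2 * N),
      (if (N : ℤ) + 1 ≤ n + t ∧ n + t ≤ 2 * N then (1 : ℝ) else 0) = N := by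
    rw [Finset.sum_ite, Finset.sum_const_zero, add_zero, Finset.sum_const, nsmul_eq_mul, mul_one]
    have e : (Icc (1 : ℤ) (2 * N)).filter (fun t => (N : ℤ) + 1 ≤ n + t ∧ n + t ≤ 2 * N) =
        Icc ((N : ℤ) + 1 - n) (2 * N - n) := by
      ext t
      simp only [Finset.mem_filter, Finset.mem_Icc]
      omega
    rw [e, Int.card_Icc]
    have e2 : (2 * (N : ℤ) - n + 1 - ((N : ℤ) + 1 - n)).toNat = N := by omega
    rw [e2]
  unfold shiftBox windowWeight
  rw [Finset.sum_prod_piFinset (Icc (1 : ℤ) (2 * N))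
    (fun (_ : Fin k) (t : ℤ) => if (N : ℤ) + 1 ≤ n + t ∧ n + t ≤ 2 * N then (1 : ℝ) else 0)]
  rw [Finset.prod_congr rfl fun j _ => h1, Finset.prod_const, Finset.card_univ, Fintype.card_fin]

/-- **Averaging over the shifts**: `N^k ∑_{n ∈ [N]} G(n) = ∑_{n ∈ [N], h ∈ [1,2N]^k} w(n,h) G(n)`.
[cite: GreenTao2010, §11, proof of Prop. 11.2] -/
theorem pow_mul_sum_eq_sum_windowWeight (N : ℕ) (G : ℤ → ℝ) :
    (N : ℝ) ^ k * ∑ n ∈ Icc (1 : ℤ) N, G n =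
      ∑ p ∈ Icc (1 : ℤ) N ×ˢ shiftBox k N, windowWeight N p.1 p.2 * G p.1 := by
  rw [Finset.sum_product, Finset.mul_sum]
  refine Finset.sum_congr rfl fun n hn => ?_
  rw [Finset.mem_Icc] at hn
  change (N : ℝ) ^ k * G n = ∑ y ∈ shiftBox k N, windowWeight N n y * G n
  rw [← Finset.sum_mul, sum_windowWeight_eq hn.1 hn.2]

/-- **The approximation step**: if `a(m)` is within `ε` of `∑_i c_i ∏_ω b_{i,ω}(m + ω·h)` for
`m ∈ [N]` and shifts `h ≥ 1`, then
`|N^k ∑_{n∈[N]} f(n) a(n) - ∑_i c_i T_N(f; b_i)| ≤ ε N^k ∑_{n∈[N]} |f(n)|`.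
[cite: GreenTao2010, §11, proof of Prop. 11.2] -/
theorem abs_pow_mul_sum_sub_sum_cubeSum_le {N : ℕ} {ε : ℝ} (a : ℤ → ℝ) {ι : Type*} [Fintype ι]
    (c : ι → ℝ) (b : ι → Finset (Fin k) → ℤ → ℝ)
    (happrox : ∀ (m : ℤ) (h : Fin k → ℤ), 1 ≤ m → m ≤ N → (∀ j, 1 ≤ h j) →
      |a m - ∑ i, c i * ∏ ω : Finset (Fin k), b i ω (m + ∑ j ∈ ω, h j)| ≤ ε)
    (f : ℤ → ℝ) :
    |(N : ℝ) ^ k * ∑ n ∈ Icc (1 : ℤ) N, f n * a n - ∑ i, c i * cubeSum N f (b i)| ≤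
      ε * ((N : ℝ) ^ k * ∑ n ∈ Icc (1 : ℤ) N, |f n|) := by
  classical
  set A : Finset (ℤ × (Fin k → ℤ)) := Icc (1 : ℤ) N ×ˢ shiftBox k N with hA
  set w : ℤ × (Fin k → ℤ) → ℝ := fun p => windowWeight N p.1 p.2 with hw
  set Q : ι → ℤ × (Fin k → ℤ) → ℝ := fun i p =>
    ∏ ω : Finset (Fin k), b i ω (p.1 + ∑ j ∈ ω, p.2 j) with hQ
  have hT : ∀ i, cubeSum N f (b i) = ∑ p ∈ A, w p * (f p.1 * Q i p) := fun i => rfl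
  have e1 : ∑ i, c i * cubeSum N f (b i) = ∑ p ∈ A, w p * (f p.1 * ∑ i, c i * Q i p) := by
    calc ∑ i, c i * cubeSum N f (b i) = ∑ i, ∑ p ∈ A, c i * (w p * (f p.1 * Q i p)) := by
          refine Finset.sum_congr rfl fun i _ => ?_
          rw [hT i, Finset.mul_sum]
      _ = ∑ p ∈ A, ∑ i, c i * (w p * (f p.1 * Q i p)) := Finset.sum_comm
      _ = ∑ p ∈ A, w p * (f p.1 * ∑ i, c i * Q i p) := by
          refine Finset.sum_congr rfl fun p _ => ?_
          rw [Finset.mul_sum, Finset.mul_sum]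
          exact Finset.sum_congr rfl fun i _ => by ring
  rw [pow_mul_sum_eq_sum_windowWeight N (fun n => f n * a n),
    pow_mul_sum_eq_sum_windowWeight N (fun n => |f n|), e1, ← Finset.sum_sub_distrib, Finset.mul_sum]
  refine (Finset.abs_sum_le_sum_abs _ _).trans (Finset.sum_le_sum fun p hp => ?_)
  rw [Finset.mem_product, Finset.mem_Icc, mem_shiftBox] at hp
  have hap := happrox p.1 p.2 hp.1.1 hp.1.2 fun j => (hp.2 j).1
  have hw0 : 0 ≤ w p := windowWeight_nonneg N p.1 p.2
  change |w p * (f p.1 * a p.1) - w p * (f p.1 * ∑ i, c i * Q i p)| ≤ ε * (w p * |f p.1|)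
  rw [← mul_sub, ← mul_sub, abs_mul, abs_mul, abs_of_nonneg hw0]
  calc w p * (|f p.1| * |a p.1 - ∑ i, c i * Q i p|) ≤ w p * (|f p.1| * ε) :=
        mul_le_mul_of_nonneg_left (mul_le_mul_of_nonneg_left hap (abs_nonneg _)) hw0
    _ = ε * (w p * |f p.1|) := by ring

/-- `T_N(f; b)` is linear in `f`. [folklore] -/
theorem cubeSum_add (N : ℕ) (f₁ f₂ : ℤ → ℝ) (b : Finset (Fin k) → ℤ → ℝ) :
    cubeSum N (fun n => f₁ n + f₂ n) b = cubeSum N f₁ b + cubeSum N f₂ b := by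
  unfold cubeSum
  rw [← Finset.sum_add_distrib]
  exact Finset.sum_congr rfl fun p _ => by ring

/-- **The trivial bound** `|T_N(f; b)| ≤ N^k ∑_{n∈[N]} |f(n)|` for `1`-bounded `b`.
[folklore] -/
theorem abs_cubeSum_le_sum_abs (N : ℕ) (f : ℤ → ℝ) (b : Finset (Fin k) → ℤ → ℝ)
    (hb : ∀ ω m, |b ω m| ≤ 1) :
    |cubeSum N f b| ≤ (N : ℝ) ^ k * ∑ n ∈ Icc (1 : ℤ) N, |f n| := by
  unfold cubeSum
  rw [pow_mul_sum_eq_sum_windowWeight N (fun n => |f n|)]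
  refine (Finset.abs_sum_le_sum_abs _ _).trans (Finset.sum_le_sum fun p _ => ?_)
  have hw0 : 0 ≤ windowWeight N p.1 p.2 := windowWeight_nonneg N p.1 p.2
  rw [abs_mul, abs_of_nonneg hw0, abs_mul]
  refine mul_le_mul_of_nonneg_left ?_ hw0
  have hQ : |∏ ω : Finset (Fin k), b ω (p.1 + ∑ j ∈ ω, p.2 j)| ≤ 1 := by
    rw [Finset.abs_prod]
    exact Finset.prod_le_one (fun _ _ => abs_nonneg _) fun ω _ => hb ω _
  calc |f p.1| * |∏ ω : Finset (Fin k), b ω (p.1 + ∑ j ∈ ω, p.2 j)| ≤ |f p.1| * 1 :=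
        mul_le_mul_of_nonneg_left hQ (abs_nonneg _)
    _ = |f p.1| := mul_one _

/-- **The Gowers–Cauchy–Schwarz bound for the window-averaged cube sum** (Steps (11.5)–(11.8) of
the proof of Prop. 11.2, in the real, wrap-around-free form of this series):
`|T_N(f; b)| ≤ (2(2k+1))^{k+1} N · N^k ‖f‖_{U^k[N]}` for `1`-bounded `b_ω`, `ω ≠ ∅`, and `b_∅ = 1`
— i.e. the averaged sequence has `U^k[N]`-dual norm `≤ (2(2k+1))^{k+1}`.
[cite: GreenTao2010, §11, proof of Prop. 11.2 ((11.5)–(11.8)) and App. B, Lemma B.5] -/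
theorem abs_cubeSum_le_uniformityNorm {N : ℕ} (hk : 1 ≤ k) (hN : 1 ≤ N) (f : ℤ → ℝ)
    (b : Finset (Fin k) → ℤ → ℝ) (hb1 : ∀ ω m, ω ≠ ∅ → |b ω m| ≤ 1) (hb0 : ∀ m, b ∅ m = 1) :
    |cubeSum N f b| ≤ (2 * (2 * k + 1)) ^ (k + 1) * N * (N : ℝ) ^ k *
      uniformityNorm k N (fun n => ((f n : ℝ) : ℂ)) := by
  classical
  -- parameters
  set V : ℕ := (2 * k + 1) * N with hV
  set N'' : ℕ := 2 * V with hN''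
  have hV1 : 1 ≤ V := by rw [hV]; nlinarith
  haveI : NeZero N'' := ⟨by omega⟩
  set U := uniformityNorm k N (fun n => ((f n : ℝ) : ℂ)) with hU
  have hU0 : 0 ≤ U := uniformityNorm_nonneg _ _ _
  set A : Finset (ℤ × (Fin k → ℤ)) := Icc (1 : ℤ) N ×ˢ shiftBox k N with hA
  set w : ℤ × (Fin k → ℤ) → ℝ := fun p => windowWeight N p.1 p.2 with hw
  set Q : ℤ × (Fin k → ℤ) → ℝ := fun p =>
    ∏ ω : Finset (Fin k), b ω (p.1 + ∑ j ∈ ω, p.2 j) with hQ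
  have hT : cubeSum N f b = ∑ p ∈ A, w p * (f p.1 * Q p) := rfl
  -- the vertex family
  set Fam : Finset (Fin k) → ℤ → ℝ := fun ω m =>
    if ω = ∅ then (if 1 ≤ m ∧ m ≤ N then f m else 0)
    else if ω.card = 1 then (if (N : ℤ) + 1 ≤ m ∧ m ≤ 2 * N then b ω m else 0)
    else (if 1 ≤ m ∧ m ≤ V then b ω m else 0) with hFam
  set φ : ℤ × (Fin k → ℤ) → ℝ := fun p =>
    ∏ ω : Finset (Fin k), Fam ω (cubeVertex p.1 p.2 ω) with hφ
  have hFam1 : ∀ ω m, ω ≠ ∅ → |Fam ω m| ≤ 1 := by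
    intro ω m hω
    simp only [hFam, hω, if_false]
    split_ifs <;> simp [hb1 ω m hω]
  -- membership facts
  have hmemA : ∀ p ∈ A, (1 ≤ p.1 ∧ p.1 ≤ N) ∧ ∀ j, 1 ≤ p.2 j ∧ p.2 j ≤ 2 * N := by
    intro p hp
    rw [hA, Finset.mem_product, Finset.mem_Icc, mem_shiftBox] at hp
    exact hp
  -- the vertex bound `1 ≤ x + ω·h ≤ V` on `A`
  have hvertex : ∀ p ∈ A, ∀ ω : Finset (Fin k),
      1 ≤ cubeVertex p.1 p.2 ω ∧ cubeVertex p.1 p.2 ω ≤ V := by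
    intro p hp ω
    obtain ⟨hp1, hph⟩ := hmemA p hp
    unfold cubeVertex
    have hs0 : 0 ≤ ∑ j ∈ ω, p.2 j := Finset.sum_nonneg fun j _ => by linarith [(hph j).1]
    have hs1 : ∑ j ∈ ω, p.2 j ≤ ∑ _j ∈ ω, (2 * N : ℤ) := Finset.sum_le_sum fun j _ => (hph j).2
    rw [Finset.sum_const, nsmul_eq_mul] at hs1
    have hcardω : (ω.card : ℤ) ≤ k := by
      exact_mod_cast (Finset.card_le_univ ω).trans (by rw [Fintype.card_fin])
    have hVZ : (V : ℤ) = (2 * k + 1) * N := by rw [hV]; push_cast; ring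
    constructor
    · linarith
    · have : (ω.card : ℤ) * (2 * N) ≤ k * (2 * N) := by
        have hN0 : (0 : ℤ) ≤ 2 * N := by positivity
        nlinarith
      linarith
  -- on `A`, the weighted cube product is the family product
  have hφA : ∀ p ∈ A, w p * (f p.1 * Q p) = φ p := by
    intro p hp
    obtain ⟨hp1, hph⟩ := hmemA p hp
    have hwp : w p = windowWeight N p.1 p.2 := rfl
    rw [hwp, windowWeight_eq_ite]
    by_cases hall : ∀ j, (N : ℤ) + 1 ≤ p.1 + p.2 j ∧ p.1 + p.2 j ≤ 2 * N
    · rw [if_pos hall, one_mul]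
      have key : ∀ ω : Finset (Fin k), Fam ω (cubeVertex p.1 p.2 ω) =
          (if ω = ∅ then f p.1 else 1) * b ω (cubeVertex p.1 p.2 ω) := by
        intro ω
        by_cases hω : ω = ∅
        · subst hω
          simp only [hFam, if_true, cubeVertex_empty, hb0, mul_one]
          rw [if_pos hp1]
        · by_cases hc : ω.card = 1
          · obtain ⟨j, rfl⟩ := Finset.card_eq_one.mp hc
            simp only [hFam, hω, if_false, hc, if_true, cubeVertex_singleton, one_mul]
            rw [if_pos (hall j)]
          · simp only [hFam, hω, if_false, hc, one_mul]
            rw [if_pos (hvertex p hp ω)]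
      simp only [hφ, hQ]
      rw [Finset.prod_congr rfl fun ω _ => key ω, Finset.prod_mul_distrib]
      congr 1
      · rw [Finset.prod_ite_eq']
        simp
    · rw [if_neg hall, zero_mul]
      push Not at hall
      obtain ⟨j, hj⟩ := hall
      symm
      refine Finset.prod_eq_zero (Finset.mem_univ ({j} : Finset (Fin k))) ?_
      have hne : ({j} : Finset (Fin k)) ≠ ∅ := Finset.singleton_ne_empty j
      simp only [hFam, hne, if_false, Finset.card_singleton, if_true, cubeVertex_singleton]
      rw [if_neg]
      intro h
      have := hj h.1
      omega
  -- off `A`, the family product vanishes on the cubes of `[V]`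
  have hφ_off_A : ∀ p ∈ gowersCubeParams k V, p ∉ A → φ p = 0 := by
    intro p hp hpA
    by_cases h1 : 1 ≤ p.1 ∧ p.1 ≤ N
    · have h2 : ¬ ∀ j, 1 ≤ p.2 j ∧ p.2 j ≤ 2 * N := by
        intro hall
        apply hpA
        rw [hA, Finset.mem_product, Finset.mem_Icc, mem_shiftBox]
        exact ⟨h1, hall⟩
      push Not at h2
      obtain ⟨j, hj⟩ := h2
      refine Finset.prod_eq_zero (Finset.mem_univ ({j} : Finset (Fin k))) ?_
      have hne : ({j} : Finset (Fin k)) ≠ ∅ := Finset.singleton_ne_empty j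
      simp only [hFam, hne, if_false, Finset.card_singleton, if_true, cubeVertex_singleton]
      rw [if_neg]
      intro h
      have h3 : 1 ≤ p.2 j := by omega
      have h4 := hj h3
      omega
    · refine Finset.prod_eq_zero (Finset.mem_univ (∅ : Finset (Fin k))) ?_
      simp only [hFam, if_true, cubeVertex_empty]
      rw [if_neg h1]
  -- off the cubes of `[V]`, the family product vanishes on `A`
  have hφ_off_P : ∀ p ∈ A, p ∉ gowersCubeParams k V → φ p = 0 := by
    intro p hp hpP
    exfalso
    exact hpP (mem_gowersCubeParams.mpr fun ω => Finset.mem_Icc.mpr (hvertex p hp ω))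
  have hT_eq : cubeSum N f b = ∑ p ∈ gowersCubeParams k V, φ p := by
    rw [hT, Finset.sum_congr rfl hφA]
    have h1 : ∑ p ∈ A ∩ gowersCubeParams k V, φ p = ∑ p ∈ A, φ p :=
      Finset.sum_subset Finset.inter_subset_left fun p hpA hpn =>
        hφ_off_P p hpA fun hpP => hpn (Finset.mem_inter.mpr ⟨hpA, hpP⟩)
    have h2 : ∑ p ∈ A ∩ gowersCubeParams k V, φ p = ∑ p ∈ gowersCubeParams k V, φ p :=
      Finset.sum_subset Finset.inter_subset_right fun p hpP hpn =>
        hφ_off_A p hpP fun hpA => hpn (Finset.mem_inter.mpr ⟨hpA, hpP⟩)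
    rw [← h1, h2]
  -- the Gowers–Cauchy–Schwarz bound
  have h2V : 2 * V ≤ N'' := le_rfl
  have hTi : |cubeSum N f b| ≤ (N'' : ℝ) ^ (k + 1) * U := by
    rw [hT_eq, sum_cubeParams_eq_card_mul_gowersInner h2V Fam, abs_mul,
      abs_of_nonneg (by positivity)]
    refine mul_le_mul_of_nonneg_left ?_ (by positivity)
    refine (abs_gowersInner_le hk _).trans ?_
    rw [Fintype.prod_eq_mul_prod_compl (∅ : Finset (Fin k))]
    have hmain : gowersPower k (extendByZero N'' V (Fam ∅)) ^ ((2 ^ k : ℕ) : ℝ)⁻¹ ≤ U := by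
      have hext : extendByZero N'' V (Fam ∅) = extendByZero N'' N f := by
        funext y
        unfold extendByZero
        simp only [hFam, if_true]
        by_cases hy : 1 ≤ y.val ∧ y.val ≤ N
        · have hy' : 1 ≤ y.val ∧ y.val ≤ V := ⟨hy.1, hy.2.trans (by rw [hV]; nlinarith)⟩
          rw [if_pos hy', if_pos hy, if_pos]
          exact ⟨by exact_mod_cast hy.1, by exact_mod_cast hy.2⟩
        · rw [if_neg hy]
          split_ifs with h1 h2
          · exfalso; exact hy ⟨by exact_mod_cast h2.1, by exact_mod_cast h2.2⟩
          · rfl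
          · rfl
      rw [hext]
      have hpow := gowersPower_extendByZero_le_uniformityNorm_pow hk hN
        (show 2 * N + 1 ≤ N'' by rw [hN'', hV]; nlinarith) f
      have hm0 : (2 ^ k : ℕ) ≠ 0 := by positivity
      calc gowersPower k (extendByZero N'' N f) ^ ((2 ^ k : ℕ) : ℝ)⁻¹
          ≤ (U ^ (2 ^ k)) ^ ((2 ^ k : ℕ) : ℝ)⁻¹ :=
            Real.rpow_le_rpow (gowersPower_nonneg hk _) hpow (by positivity)
        _ = U := Real.pow_rpow_inv_natCast hU0 hm0
    have hrest : ∏ ω ∈ ({∅} : Finset (Finset (Fin k)))ᶜ,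
        gowersPower k (extendByZero N'' V (Fam ω)) ^ ((2 ^ k : ℕ) : ℝ)⁻¹ ≤ 1 := by
      refine Finset.prod_le_one (fun ω _ => Real.rpow_nonneg (gowersPower_nonneg hk _) _)
        fun ω hω => ?_
      have hω : ω ≠ ∅ := by simpa using hω
      refine Real.rpow_le_one (gowersPower_nonneg hk _) (gowersPower_le_one_of_abs_le fun y => ?_)
        (by positivity)
      unfold extendByZero
      split_ifs
      · exact hFam1 ω _ hω
      · simp
    calc _ ≤ U * 1 := mul_le_mul hmain hrest (Finset.prod_nonneg fun ω _ =>
          Real.rpow_nonneg (gowersPower_nonneg hk _) _) hU0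
      _ = U := mul_one U
  have hN''eq : (N'' : ℝ) ^ (k + 1) = (2 * (2 * k + 1)) ^ (k + 1) * N * (N : ℝ) ^ k := by
    rw [hN'', hV]
    push_cast
    rw [show (2 * ((2 * (k : ℝ) + 1) * N)) = (2 * (2 * k + 1)) * N by ring, mul_pow, pow_succ,
      pow_succ]
    ring
  rw [hN''eq] at hTi
  exact hTi

/-! #### The window as an interval in `n` -/

/-- The lower end `max(1, max_j (N + 1 - h_j))` of the window in `n`. [folklore] -/
def windowLo (N : ℕ) (h : Fin k → ℤ) : ℤ := Finset.univ.fold max 1 fun j => (N : ℤ) + 1 - h j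

/-- The upper end `min(N, min_j (2N - h_j))` of the window in `n`. [folklore] -/
def windowHi (N : ℕ) (h : Fin k → ℤ) : ℤ := Finset.univ.fold min (N : ℤ) fun j => 2 * (N : ℤ) - h j

/-- `1 ≤ lo(h)`. [folklore] -/
theorem one_le_windowLo (N : ℕ) (h : Fin k → ℤ) : 1 ≤ windowLo N h :=
  (Finset.le_fold_max 1).mpr (Or.inl le_rfl)

/-- `hi(h) ≤ N`. [folklore] -/
theorem windowHi_le (N : ℕ) (h : Fin k → ℤ) : windowHi N h ≤ N :=
  (Finset.fold_min_le (N : ℤ)).mpr (Or.inl le_rfl)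

/-- The window `{n ∈ [N] : n + h_j ∈ [N+1, 2N] ∀ j}` is the interval `[lo(h), hi(h)]`. [folklore] -/
theorem mem_Icc_window_iff {N : ℕ} {h : Fin k → ℤ} {n : ℤ} :
    n ∈ Icc (windowLo N h) (windowHi N h) ↔
      (1 ≤ n ∧ n ≤ N) ∧ ∀ j, (N : ℤ) + 1 ≤ n + h j ∧ n + h j ≤ 2 * N := by
  rw [Finset.mem_Icc, windowLo, windowHi, Finset.fold_max_le, Finset.le_fold_min]
  simp only [Finset.mem_univ, forall_true_left]
  constructor
  · rintro ⟨⟨h1, h2⟩, ⟨h3, h4⟩⟩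
    exact ⟨⟨h1, h3⟩, fun j => ⟨by linarith [h2 j], by linarith [h4 j]⟩⟩
  · rintro ⟨⟨h1, h3⟩, hall⟩
    exact ⟨⟨h1, fun j => by linarith [(hall j).1]⟩, ⟨h3, fun j => by linarith [(hall j).2]⟩⟩

/-- **The window-averaged cube sum as a sum of interval correlations**:
`T_N(f; b) = ∑_{h ∈ [1,2N]^k} ∑_{n ∈ [lo(h), hi(h)]} f(n) ∏_ω b_ω(n + ω·h)` — an average of
correlations of `f` over subintervals of `[N]` with the product sequences `n ↦ ∏_ω b_ω(n + ω·h)`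
(for `b_ω(m) = H_ω(g^m x)`: nilsequences with base points `g^{ω·h} x`; this is how "`F_1` is an
averaged nilsequence" is used in §12). [cite: GreenTao2010, §11, Def. 11.1 and §12 (proof of (12.5))] -/
theorem cubeSum_eq_sum_window (N : ℕ) (f : ℤ → ℝ) (b : Finset (Fin k) → ℤ → ℝ) :
    cubeSum N f b = ∑ h ∈ shiftBox k N, ∑ n ∈ Icc (windowLo N h) (windowHi N h),
      f n * ∏ ω : Finset (Fin k), b ω (n + ∑ j ∈ ω, h j) := by
  classical
  unfold cubeSum
  rw [Finset.sum_product_right]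
  refine Finset.sum_congr rfl fun h _ => ?_
  have hset : (Icc (1 : ℤ) N).filter (fun n => ∀ j, (N : ℤ) + 1 ≤ n + h j ∧ n + h j ≤ 2 * N) =
      Icc (windowLo N h) (windowHi N h) := by
    ext n
    rw [Finset.mem_filter, Finset.mem_Icc, mem_Icc_window_iff]
  rw [← hset, Finset.sum_filter]
  refine Finset.sum_congr rfl fun n _ => ?_
  rw [windowWeight_eq_ite]
  split_ifs <;> simp

/-- An integer interval sum with `lo ≥ 1` is the corresponding sum over `ℕ`. [folklore] -/
theorem sum_Icc_int_eq_sum_Icc_toNat {lo hi : ℤ} (hlo : 1 ≤ lo) (G : ℤ → ℝ) :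
    ∑ n ∈ Icc lo hi, G n = ∑ n ∈ Icc lo.toNat hi.toNat, G (n : ℕ) := by
  classical
  have himage : (Icc lo.toNat hi.toNat).image (fun n : ℕ => (n : ℤ)) = Icc lo hi := by
    ext m
    simp only [Finset.mem_image, Finset.mem_Icc]
    constructor
    · rintro ⟨n, ⟨h1, h2⟩, rfl⟩
      exact ⟨by omega, by omega⟩
    · rintro ⟨h1, h2⟩
      exact ⟨m.toNat, ⟨by omega, by omega⟩, by omega⟩
  rw [← himage, Finset.sum_image fun a _ b _ h => by exact_mod_cast h]

end cubesum

namespace Nilmanifold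

open HostKra

variable {s : ℕ} (X : Nilmanifold s)

/-! ### Bounded Lipschitz functions form an algebra separating points -/

/-- "Bounded Lipschitz with some constant": `|H| ≤ K` and `|H(y) - H(z)| ≤ K d(y,z)` for some
`K ≥ 0` (the class of tensor factors in the Stone–Weierstrass step of Prop. 11.2: "a finite linear
combination of tensor products of bounded Lipschitz functions on `G/Γ`").
[cite: GreenTao2010, §11, proof of Prop. 11.2] -/
def IsLip (H : X.G ⧸ X.Γ → ℝ) : Prop :=
  ∃ K : ℝ, 0 ≤ K ∧ (∀ y, |H y| ≤ K) ∧ ∀ y z, |H y - H z| ≤ K * X.dist y z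

/-- A Lipschitz function on `(G/Γ, d_{G/Γ})` is continuous. [folklore] -/
theorem continuous_of_lipschitz {K : ℝ} {H : X.G ⧸ X.Γ → ℝ}
    (hH : ∀ y z, |H y - H z| ≤ K * X.dist y z) : Continuous H := by
  rw [continuous_def]
  intro V hV
  rw [X.isOpen_iff]
  intro x hx
  obtain ⟨r, hr, hball⟩ := Metric.isOpen_iff.mp hV (H x) hx
  refine ⟨r / (|K| + 1), by positivity, fun y hy => hball ?_⟩
  rw [Metric.mem_ball, Real.dist_eq, abs_sub_comm]
  have hd := X.dist_nonneg x y
  have hlt : |K| * (r / (|K| + 1)) < r := by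
    rw [mul_div_assoc', div_lt_iff₀ (by positivity)]
    nlinarith [abs_nonneg K]
  calc |H x - H y| ≤ K * X.dist x y := hH x y
    _ ≤ |K| * X.dist x y := mul_le_mul_of_nonneg_right (le_abs_self K) hd
    _ ≤ |K| * (r / (|K| + 1)) := mul_le_mul_of_nonneg_left hy.le (abs_nonneg K)
    _ < r := hlt

/-- Bounded Lipschitz functions are continuous. [folklore] -/
theorem IsLip.continuous {X : Nilmanifold s} {H : X.G ⧸ X.Γ → ℝ} (hH : X.IsLip H) : Continuous H := by
  obtain ⟨K, -, -, hK⟩ := hH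
  exact X.continuous_of_lipschitz hK

/-- Constants are bounded Lipschitz. [folklore] -/
theorem isLip_const (c : ℝ) : X.IsLip fun _ => c :=
  ⟨|c|, abs_nonneg c, fun _ => le_rfl, fun y z => by
    rw [sub_self, abs_zero]; exact mul_nonneg (abs_nonneg c) (X.dist_nonneg y z)⟩

/-- Products of bounded Lipschitz functions are bounded Lipschitz ("the Lipschitz nilsequences
form an algebra"). [cite: GreenTao2010, §8 (remarks after Def. 8.1) and §11] -/
theorem IsLip.mul {X : Nilmanifold s} {H₁ H₂ : X.G ⧸ X.Γ → ℝ} (h₁ : X.IsLip H₁) (h₂ : X.IsLip H₂) :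
    X.IsLip fun y => H₁ y * H₂ y := by
  obtain ⟨K₁, hK₁, hb₁, hl₁⟩ := h₁
  obtain ⟨K₂, hK₂, hb₂, hl₂⟩ := h₂
  refine ⟨2 * K₁ * K₂, by positivity, fun y => ?_, fun y z => ?_⟩
  · rw [abs_mul]
    calc |H₁ y| * |H₂ y| ≤ K₁ * K₂ := mul_le_mul (hb₁ y) (hb₂ y) (abs_nonneg _) hK₁
      _ ≤ 2 * K₁ * K₂ := by nlinarith [mul_nonneg hK₁ hK₂]
  · have hd := X.dist_nonneg y z
    have e : H₁ y * H₂ y - H₁ z * H₂ z = H₁ y * (H₂ y - H₂ z) + (H₁ y - H₁ z) * H₂ z := by ring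
    rw [e]
    calc |H₁ y * (H₂ y - H₂ z) + (H₁ y - H₁ z) * H₂ z|
        ≤ |H₁ y * (H₂ y - H₂ z)| + |(H₁ y - H₁ z) * H₂ z| := abs_add_le _ _
      _ = |H₁ y| * |H₂ y - H₂ z| + |H₁ y - H₁ z| * |H₂ z| := by rw [abs_mul, abs_mul]
      _ ≤ K₁ * (K₂ * X.dist y z) + K₁ * X.dist y z * K₂ :=
          add_le_add (mul_le_mul (hb₁ y) (hl₂ y z) (abs_nonneg _) hK₁)
            (mul_le_mul (hl₁ y z) (hb₂ z) (abs_nonneg _) (mul_nonneg hK₁ hd))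
      _ = 2 * K₁ * K₂ * X.dist y z := by ring

/-- The truncated distance `z ↦ min(d(z, p), 1)` to a point is bounded Lipschitz (constant `1`).
[folklore] -/
theorem isLip_truncDist (p : X.G ⧸ X.Γ) : X.IsLip fun z => min (X.dist z p) 1 := by
  refine ⟨1, zero_le_one, fun y => ?_, fun y z => ?_⟩
  · rw [abs_of_nonneg (le_min (X.dist_nonneg y p) zero_le_one)]
    exact min_le_right _ _
  · rw [one_mul]
    calc |min (X.dist y p) 1 - min (X.dist z p) 1|
        ≤ max |X.dist y p - X.dist z p| |(1 : ℝ) - 1| := abs_min_sub_min_le_max _ _ _ _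
      _ = |X.dist y p - X.dist z p| := by
          rw [sub_self, abs_zero, max_eq_left (abs_nonneg _)]
      _ ≤ X.dist y z := by
          rw [abs_sub_le_iff]
          constructor
          · linarith [X.dist_triangle y z p]
          · linarith [X.dist_triangle z y p, X.dist_comm z y]

/-- The subalgebra of `C(Σ', ℝ)` generated by the vertex evaluations `y ↦ H(y_ω)`, `ω ≠ 0^{s+1}`,
`H` bounded Lipschitz on `G/Γ`. [cite: GreenTao2010, §11, proof of Prop. 11.2] -/
def cubeAlgebraLip : Subalgebra ℝ C(X.cubeSpace, ℝ) :=
  Algebra.adjoin ℝ (Set.range fun p : PuncturedVertex (s + 1) × {H : X.G ⧸ X.Γ → ℝ // X.IsLip H} =>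
    X.vertexEval p.1 ⟨p.2.1, p.2.2.continuous⟩)

/-- The Lipschitz vertex evaluations separate the points of the cube space (corner constraint,
Lemma E.7 / Prop. 11.5, and the Lipschitz function `min(d(·, y_ω), 1)`).
[cite: GreenTao2010, §11, proof of Prop. 11.2] -/
theorem cubeAlgebraLip_separatesPoints : X.cubeAlgebraLip.SeparatesPoints := by
  intro y y' hne
  have hex : ∃ ω : PuncturedVertex (s + 1), y.1 ω.1 ≠ y'.1 ω.1 := by
    by_contra hall
    push Not at hall
    apply hne
    apply Subtype.ext
    funext ω
    by_cases hω : ω = fun _ => false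
    · subst hω
      exact X.cubeSpace_apply_bot_eq y.2 y'.2 fun ω hω => hall ⟨ω, hω⟩
    · exact hall ⟨ω, hω⟩
  obtain ⟨ω, hω⟩ := hex
  refine ⟨X.vertexEval ω ⟨fun z => min (X.dist z (y.1 ω.1)) 1, (X.isLip_truncDist _).continuous⟩,
    ⟨_, Algebra.subset_adjoin ⟨(ω, ⟨_, X.isLip_truncDist (y.1 ω.1)⟩), rfl⟩, rfl⟩, ?_⟩
  simp only [vertexEval, ContinuousMap.coe_mk, X.dist_self, ne_eq]
  intro h
  have h1 : min (X.dist (y'.1 ω.1) (y.1 ω.1)) 1 = 0 := by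
    rw [← h]; simp
  have h2 : X.dist (y'.1 ω.1) (y.1 ω.1) = 0 := by
    rcases min_choice (X.dist (y'.1 ω.1) (y.1 ω.1)) 1 with h3 | h3
    · rw [← h3]; exact h1
    · rw [h3] at h1; exact absurd h1 one_ne_zero
  exact hω (X.eq_of_dist_eq_zero _ _ h2).symm

/-- Every element of the Lipschitz cube algebra is a finite combination of tensor products
`∏_{ω ≠ 0^{s+1}} H_ω(y_ω)` of bounded Lipschitz functions. [folklore] -/
theorem exists_sum_vertexProd_of_mem_lip {Ψ : C(X.cubeSpace, ℝ)} (hΨ : Ψ ∈ X.cubeAlgebraLip) :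
    ∃ (n : ℕ) (c : Fin n → ℝ) (H : Fin n → PuncturedVertex (s + 1) → C(X.G ⧸ X.Γ, ℝ)),
      (∀ i ω, X.IsLip (H i ω)) ∧ Ψ = ∑ i, c i • X.vertexProd (H i) := by
  classical
  set S := Set.range fun p : PuncturedVertex (s + 1) × {H : X.G ⧸ X.Γ → ℝ // X.IsLip H} =>
    X.vertexEval p.1 ⟨p.2.1, p.2.2.continuous⟩
  have hspan : Ψ ∈ Submodule.span ℝ (Submonoid.closure S : Set C(X.cubeSpace, ℝ)) := by
    have e := Algebra.adjoin_eq_span (R := ℝ) S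
    rw [← e]
    exact hΨ
  obtain ⟨n, c, g, hsum⟩ := Submodule.mem_span_set'.mp hspan
  have hvp' : ∀ Ψ ∈ Submonoid.closure S, ∃ H : PuncturedVertex (s + 1) → C(X.G ⧸ X.Γ, ℝ),
      (∀ ω, X.IsLip (H ω)) ∧ Ψ = X.vertexProd H := by
    intro Ψ hΨ
    induction hΨ using Submonoid.closure_induction with
    | mem x hx =>
      obtain ⟨⟨ω, H, hH⟩, rfl⟩ := hx
      refine ⟨Function.update (fun _ => 1) ω ⟨H, hH.continuous⟩, fun ω' => ?_, ?_⟩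
      · by_cases hω' : ω' = ω
        · subst hω'
          rw [Function.update_self]
          exact hH
        · rw [Function.update_of_ne hω']
          exact X.isLip_const 1
      · ext y
        rw [vertexEval_apply, vertexProd_apply, Finset.prod_eq_single ω]
        · simp
        · intro ω' _ hne
          simp [Function.update_of_ne hne]
        · simp
    | one => exact ⟨fun _ => 1, fun _ => X.isLip_const 1, by ext y; simp⟩
    | mul Ψ₁ Ψ₂ _ _ h₁ h₂ =>
      obtain ⟨H₁, hH₁, rfl⟩ := h₁
      obtain ⟨H₂, hH₂, rfl⟩ := h₂
      exact ⟨fun ω => H₁ ω * H₂ ω, fun ω => (hH₁ ω).mul (hH₂ ω),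
        by ext y; simp [Finset.prod_mul_distrib]⟩
  have hvp : ∀ i, ∃ H : PuncturedVertex (s + 1) → C(X.G ⧸ X.Γ, ℝ),
      (∀ ω, X.IsLip (H ω)) ∧ (g i : C(X.cubeSpace, ℝ)) = X.vertexProd H := fun i => hvp' _ (g i).2
  choose H hHL hH using hvp
  refine ⟨n, c, H, hHL, ?_⟩
  rw [← hsum]
  exact Finset.sum_congr rfl fun i _ => by rw [hH i]

/-- `K ↦ IsBoundedLipschitz K F` is monotone. [folklore] -/
theorem IsBoundedLipschitz.mono {X : Nilmanifold s} {K K' : ℝ} {F : X.G ⧸ X.Γ → ℝ}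
    (h : X.IsBoundedLipschitz K F) (hKK' : K ≤ K') : X.IsBoundedLipschitz K' F :=
  ⟨h.1, fun y z => (h.2 y z).trans (mul_le_mul_of_nonneg_right hKK' (X.dist_nonneg y z))⟩

/-- The constant `1` is `1`-bounded and `K`-Lipschitz for every `K ≥ 0`. [folklore] -/
theorem isBoundedLipschitz_one {K : ℝ} (hK : 0 ≤ K) : X.IsBoundedLipschitz K fun _ => 1 :=
  ⟨fun _ => by simp, fun y z => by
    rw [sub_self, abs_zero]; exact mul_nonneg hK (X.dist_nonneg y z)⟩

/-- **Vertex-product approximation with bounded Lipschitz factors** (the Stone–Weierstrass step of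
Prop. 11.2 as printed: "a finite linear combination of tensor products of bounded Lipschitz
functions on `G/Γ`", "`H_{ω,α} : G/Γ → [-1,1]`"), with ONE Lipschitz constant `K = K(F, ε, G/Γ)`
for all the factors. [cite: GreenTao2010, §11, proof of Prop. 11.2] -/
theorem exists_vertexProd_near_lip (hX : X.IsRational) {F : X.G ⧸ X.Γ → ℝ} (hF : Continuous F)
    {ε : ℝ} (hε : 0 < ε) :
    ∃ (n : ℕ) (K : ℝ) (c : Fin n → ℝ) (H : Fin n → PuncturedVertex (s + 1) → X.G ⧸ X.Γ → ℝ),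
      0 ≤ K ∧ (∀ i ω, X.IsBoundedLipschitz K (H i ω)) ∧
        ∀ y ∈ X.cubeSpace,
          |F (y fun _ => false) - ∑ i, c i * ∏ ω, H i ω (y ω.1)| ≤ ε := by
  classical
  haveI := X.compactSpace_cubeSpace hX
  obtain ⟨Ψ, hΨ⟩ := ContinuousMap.exists_mem_subalgebra_near_continuous_of_separatesPoints
    X.cubeAlgebraLip X.cubeAlgebraLip_separatesPoints (fun y : X.cubeSpace => F (y.1 fun _ => false))
    (hF.comp ((continuous_apply _).comp continuous_subtype_val)) ε hε
  obtain ⟨n, c, H, hHL, hrep⟩ := X.exists_sum_vertexProd_of_mem_lip Ψ.2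
  choose K hK0 hKb hKl using hHL
  set Ktot : ℝ := ∑ i, ∑ ω, K i ω with hKtot
  have hKle : ∀ i ω, K i ω ≤ Ktot := by
    intro i ω
    calc K i ω ≤ ∑ ω', K i ω' :=
          Finset.single_le_sum (f := fun ω' => K i ω') (fun ω' _ => hK0 i ω') (Finset.mem_univ ω)
      _ ≤ Ktot := Finset.single_le_sum (f := fun i' => ∑ ω', K i' ω')
          (fun i' _ => Finset.sum_nonneg fun ω' _ => hK0 i' ω') (Finset.mem_univ i)
  refine ⟨n, Ktot, fun i => c i * ∏ ω, (‖H i ω‖ + 1), fun i ω z => (‖H i ω‖ + 1)⁻¹ * H i ω z,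
    Finset.sum_nonneg fun i _ => Finset.sum_nonneg fun ω _ => hK0 i ω, fun i ω => ⟨?_, ?_⟩,
    fun y hy => ?_⟩
  · intro z
    rw [abs_mul, abs_inv, abs_of_pos (by positivity), inv_mul_le_iff₀ (by positivity), mul_one]
    have h1 : |H i ω z| ≤ ‖H i ω‖ := by
      rw [← Real.norm_eq_abs]; exact (H i ω).norm_coe_le_norm z
    linarith
  · intro y z
    have hpos : 0 < ‖H i ω‖ + 1 := by positivity
    rw [← mul_sub, abs_mul, abs_inv, abs_of_pos hpos]
    have hd := X.dist_nonneg y z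
    calc (‖H i ω‖ + 1)⁻¹ * |H i ω y - H i ω z| ≤ 1 * |H i ω y - H i ω z| := by
          refine mul_le_mul_of_nonneg_right ?_ (abs_nonneg _)
          rw [inv_le_one_iff₀]
          right; linarith [norm_nonneg (H i ω)]
      _ = |H i ω y - H i ω z| := one_mul _
      _ ≤ K i ω * X.dist y z := hKl i ω y z
      _ ≤ Ktot * X.dist y z := mul_le_mul_of_nonneg_right (hKle i ω) hd
  · have hlt := hΨ ⟨y, hy⟩
    have hΨy : (Ψ : X.cubeSpace → ℝ) ⟨y, hy⟩ = ∑ i, c i * ∏ ω, H i ω (y ω.1) := by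
      have e := congrArg (fun f : C(X.cubeSpace, ℝ) => f ⟨y, hy⟩) hrep
      simpa [ContinuousMap.coe_sum] using e
    have hresc : ∀ i, (c i * ∏ ω, (‖H i ω‖ + 1)) *
        ∏ ω, ((‖H i ω‖ + 1)⁻¹ * H i ω (y ω.1)) = c i * ∏ ω, H i ω (y ω.1) := by
      intro i
      rw [Finset.prod_mul_distrib, mul_assoc, ← mul_assoc (∏ ω, (‖H i ω‖ + 1)),
        ← Finset.prod_mul_distrib, Finset.prod_congr rfl fun ω _ =>
          mul_inv_cancel₀ (show (‖H i ω‖ + 1) ≠ 0 by positivity)]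
      simp
    simp_rw [hresc]
    rw [← hΨy, abs_sub_comm]
    rw [Real.norm_eq_abs] at hlt
    exact hlt.le

/-- **Cube approximation along orbits with bounded Lipschitz factors** (Prop. 11.5 +
Stone–Weierstrass, in the indexing `ω ⊆ [s+1]` with the trivial factor at `ω = ∅`): for a
rational nilmanifold, continuous `F` and `ε > 0` there are `c_i`, a constant `K ≥ 0` and
`1`-bounded `K`-Lipschitz `B_{i,ω} : G/Γ → [-1,1]`, `B_{i,∅} = 1`, with
`|F(g^m x) - ∑_i c_i ∏_{ω ⊆ [s+1]} B_{i,ω}(g^{m + ω·h} x)| ≤ ε` for all `g, x, m, h`.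
[cite: GreenTao2010, §11, proof of Prop. 11.2 and Prop. 11.5] -/
theorem exists_cubeApprox_lip (hX : X.IsRational) {F : X.G ⧸ X.Γ → ℝ} (hF : Continuous F)
    {ε : ℝ} (hε : 0 < ε) :
    ∃ (n : ℕ) (K : ℝ) (c : Fin n → ℝ) (B : Fin n → Finset (Fin (s + 1)) → X.G ⧸ X.Γ → ℝ),
      0 ≤ K ∧ (∀ i ω, X.IsBoundedLipschitz K (B i ω)) ∧ (∀ i z, B i ∅ z = 1) ∧
        ∀ (g : X.G) (x : X.G ⧸ X.Γ) (m : ℤ) (h : Fin (s + 1) → ℤ),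
          |F (g ^ m • x) -
              ∑ i, c i * ∏ ω : Finset (Fin (s + 1)), B i ω (g ^ (m + ∑ j ∈ ω, h j) • x)| ≤ ε := by
  classical
  obtain ⟨n, K, c, H, hK0, hHL, happrox⟩ := X.exists_vertexProd_near_lip hX hF hε
  refine ⟨n, K, c, fun i ω z =>
    if hω : toVertex ω = (fun _ => false) then 1 else H i ⟨toVertex ω, hω⟩ z, hK0, ?_, ?_, ?_⟩
  · intro i ω
    by_cases hω : toVertex ω = (fun _ => false)
    · simp only [hω, dite_true]
      exact X.isBoundedLipschitz_one hK0
    · simp only [hω, dite_false]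
      exact hHL _ _
  · intro i z
    dsimp only
    rw [dif_pos ((toVertex_eq_bot_iff ∅).mpr rfl)]
  · intro g x m h
    dsimp only
    have hy := X.parallelepiped_mem_cubeSpace g x m h
    have key := happrox _ hy
    have e0 : g ^ (m + dot (fun _ : Fin (s + 1) => false) h) • x = g ^ m • x := by
      simp [dot]
    simp only [e0] at key
    set Bv : Fin n → Vertex (s + 1) → ℝ := fun i v =>
      if hv : v = (fun _ => false) then 1 else H i ⟨v, hv⟩ (g ^ (m + dot v h) • x) with hBv
    have hprod : ∀ i, ∏ ω : Finset (Fin (s + 1)),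
        (if hω : toVertex ω = (fun _ => false) then (1 : ℝ)
          else H i ⟨toVertex ω, hω⟩ (g ^ (m + ∑ j ∈ ω, h j) • x)) =
        ∏ ω : PuncturedVertex (s + 1), H i ω (g ^ (m + dot ω.1 h) • x) := by
      intro i
      have h1 : ∏ ω : Finset (Fin (s + 1)),
          (if hω : toVertex ω = (fun _ => false) then (1 : ℝ)
            else H i ⟨toVertex ω, hω⟩ (g ^ (m + ∑ j ∈ ω, h j) • x)) =
          ∏ ω : Finset (Fin (s + 1)), Bv i (vertexEquiv ω) := by
        refine Fintype.prod_congr _ _ fun ω => ?_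
        change _ = Bv i (toVertex ω)
        simp only [hBv, dot_toVertex]
      have h2 : ∏ ω : Finset (Fin (s + 1)), Bv i (vertexEquiv ω) = ∏ v : Vertex (s + 1), Bv i v :=
        Fintype.prod_equiv vertexEquiv _ _ fun ω => rfl
      have h3 : ∏ v : Vertex (s + 1), Bv i v =
          ∏ v ∈ ({(fun _ => false : Vertex (s + 1))} : Finset (Vertex (s + 1)))ᶜ, Bv i v := by
        rw [Fintype.prod_eq_mul_prod_compl (fun _ => false : Vertex (s + 1))]
        simp only [hBv, dif_pos rfl, one_mul]
      have h4 : ∏ v ∈ ({(fun _ => false : Vertex (s + 1))} : Finset (Vertex (s + 1)))ᶜ, Bv i v =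
          ∏ ω : PuncturedVertex (s + 1), Bv i ω.1 :=
        Finset.prod_subtype _ (fun v => by simp) _
      rw [h1, h2, h3, h4]
      refine Fintype.prod_congr _ _ fun ω => ?_
      simp only [hBv, dif_neg ω.2]
    simp_rw [hprod]
    exact key

end Nilmanifold

/-! ### The two analytic inputs of §12, as predicates -/

/-- **The Gowers-norm estimate for the smooth piece** (display (12.6), proved in App. D from the
Goldston–Yıldırım estimate Thm. D.3 with `a_i = 1`, "an appropriate choice would be, for example,
`γ_s := (1/10) 2^{-s}`"): for the cutoff `χ = χ♯` and the level function `R = R(N)` (`R = N^γ` in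
the paper), `‖(φ(W)/W) Λ♯(W · + b) - 1‖_{U^{s+1}[N]} = o_s(1)`, uniformly in `b ∈ [W]` coprime to `W`
and in the `W`-trick range `w₀ ≤ w ≤ ½ log log N`. A predicate (hypothesis of the reduction below),
not asserted here. [cite: GreenTao2010, §12, (12.6) and App. D, "The correlation estimate for `Λ♯`"] -/
def GreenTao2010_sharpUniformAt (s : ℕ) (χ : ℝ → ℝ) (R : ℕ → ℝ) : Prop :=
  ∀ ε : ℝ, 0 < ε → ∃ w₀ N₀ : ℕ, ∀ N : ℕ, N₀ ≤ N →
    ∀ w : ℕ, w₀ ≤ w → (w : ℝ) ≤ Real.log (Real.log N) / 2 →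
      ∀ b : ℕ, 1 ≤ b → b ≤ primorial w → Nat.Coprime b (primorial w) →
        uniformityNorm (s + 1) N
          (fun n : ℤ => ((vonMangoldtSmoothW χ (R N) (primorial w) b n.toNat - 1 : ℝ) : ℂ)) ≤ ε

/-- **Orthogonality of the rough piece to nilsequences** (display (12.7):
"`𝔼_{n ∈ [N]} (φ(W)/W) Λ♭(Wn + b) F(gⁿx) = o_{M,G/Γ,s}(1)` for all `1`-bounded `s`-step nilsequences
`F(gⁿx)` of Lipschitz constant `M` … the `o`-term is required to depend only on `M, G/Γ` and `s`,
and should be otherwise independent of `F, g` and `x`", deduced in §12 from the `MN(s)`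
conjecture) — here for the nilmanifold `X`, in the form in which the averaged nilsequence `F₁` of
Prop. 11.2 consumes it: for products `∏_{j < m} H_j(gⁿ y_j)` of `1`-bounded `K`-Lipschitz functions
on `X` along one orbit direction `g` (nilsequences on `X^m`), and uniformly over subintervals
`[lo, hi] ⊆ [N]` (both within what §12 proves: its bound `N log^{-A} N` for initial segments is
uniform in `g, x`, hence differences over subintervals, and `X^m` is again an `s`-step
nilmanifold). A predicate (hypothesis of the reduction below), not asserted here.
[cite: GreenTao2010, §12, (12.5) and (12.7)–(12.10)] -/
def GreenTao2010_flatOrthogonalAt (s : ℕ) (X : Nilmanifold s) (χ : ℝ → ℝ) (R : ℕ → ℝ) : Prop :=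
  ∀ (m : ℕ) (K ε : ℝ), 0 < ε → ∃ w₀ N₀ : ℕ, ∀ N : ℕ, N₀ ≤ N →
    ∀ w : ℕ, w₀ ≤ w → (w : ℝ) ≤ Real.log (Real.log N) / 2 →
      ∀ b : ℕ, 1 ≤ b → b ≤ primorial w → Nat.Coprime b (primorial w) →
        ∀ H : Fin m → X.G ⧸ X.Γ → ℝ, (∀ j, X.IsBoundedLipschitz K (H j)) →
          ∀ (g : X.G) (y : Fin m → X.G ⧸ X.Γ) (lo hi : ℕ), 1 ≤ lo → hi ≤ N →
            |∑ n ∈ Finset.Icc lo hi,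
                vonMangoldtSmoothW (flatCutoff χ) (R N) (primorial w) b n * ∏ j, H j (g ^ n • y j)| ≤
              ε * N

/-! ### Prop. 10.2 from the two inputs (§11 and §12 of the paper) -/

/-- **Prop. 10.2 (`W`-tricked `Λ'` orthogonal to nilsequences) for a rational nilmanifold, from
the sharp Gowers estimate (12.6) and the flat orthogonality (12.7)** — the content of §11
(Prop. 10.2 ⇐ Prop. 11.3 via the decomposition Prop. 11.2) and of the first half of §12
(Prop. 11.3 ⇐ (12.6) + (12.7)): "The contribution from the prime powers … is easily seen to be
negligible", "`Λ = Λ♯ + Λ♭`", "It is here that we need the dual norm bound", "Recall that `F₁` is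
an averaged nilsequence. From the triangle inequality, it will thus suffice to prove the bound
(12.7)". Valid for every cutoff `χ = χ♯` and level function `R` with `log R(N) ≠ 0` eventually
(so that `Λ = Λ♯ + Λ♭`). Proof: finite `ε/12`-net of the Lipschitz class and cube approximation
with common Lipschitz constant (`Nilmanifold.exists_cubeApprox_lip`); average over the `N^{s+1}`
window shifts (`abs_pow_mul_sum_sub_sum_cubeSum_le`, error `≤ (ε/6) ∑|Λ'_{b,W} - 1| ≤ (ε/2) N` by
`exists_sum_abs_vonMangoldtW_sub_one_le`); split the weight of each window-averaged cube sum as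
`(Λ'_{b,W} - Λ_{b,W}) + (Λ♯_{b,W} - 1) + Λ♭_{b,W}`: prime powers by the trivial bound and
`ψ - ϑ ≤ 2√x log x` (`exists_sum_primePowers_le`), the sharp part by the Gowers–Cauchy–Schwarz
bound `abs_cubeSum_le_uniformityNorm` and (12.6), the flat part window by window
(`cubeSum_eq_sum_window`) by (12.7). [cite: GreenTao2010, Prop. 10.2, §11 (Props. 11.2, 11.3) and §12] -/
theorem GreenTao2010_nilsequenceOrthogonalityAt_of_sharp_of_flat {s : ℕ} (X : Nilmanifold s)
    (hX : X.IsRational) (M : ℝ) (χ : ℝ → ℝ) (R : ℕ → ℝ)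
    (hR : ∀ᶠ N : ℕ in atTop, Real.log (R N) ≠ 0)
    (hSharp : GreenTao2010_sharpUniformAt s χ R) (hFlat : GreenTao2010_flatOrthogonalAt s X χ R) :
    GreenTao2010_nilsequenceOrthogonalityAt s X M := by
  classical
  intro ε hε
  -- Step 0: the finite net and the cube approximations (data depending on `ε, M, X` only)
  obtain ⟨m, Fnet, hcont, hnet⟩ := X.exists_finite_net M (show 0 < ε / 12 by positivity)
  have happ : ∀ i : Fin m, ∃ (n : ℕ) (K : ℝ) (c : Fin n → ℝ)
      (B : Fin n → Finset (Fin (s + 1)) → X.G ⧸ X.Γ → ℝ),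
      0 ≤ K ∧ (∀ i' ω, X.IsBoundedLipschitz K (B i' ω)) ∧ (∀ i' z, B i' ∅ z = 1) ∧
        ∀ (g : X.G) (x : X.G ⧸ X.Γ) (m' : ℤ) (h : Fin (s + 1) → ℤ),
          |Fnet i (g ^ m' • x) -
              ∑ i', c i' * ∏ ω : Finset (Fin (s + 1)), B i' ω (g ^ (m' + ∑ j ∈ ω, h j) • x)| ≤
            ε / 12 :=
    fun i => X.exists_cubeApprox_lip hX (hcont i) (by positivity)
  choose n K c B hK0 hBL hB0 hBapp using happ
  -- constants
  set L : ℝ := ∑ i, ∑ j, |c i j| with hL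
  have hL0 : 0 ≤ L := Finset.sum_nonneg fun i _ => Finset.sum_nonneg fun j _ => abs_nonneg _
  set Kmax : ℝ := ∑ i, K i with hKmax
  have hKle : ∀ i, K i ≤ Kmax := fun i =>
    Finset.single_le_sum (f := fun i => K i) (fun i _ => hK0 i) (Finset.mem_univ i)
  set C : ℝ := (2 * (2 * ((s : ℝ) + 1) + 1)) ^ (s + 1 + 1) with hC
  have hCpos : 0 < C := by positivity
  set η : ℝ := ε / (6 * (L + 1)) with hη
  have hη0 : 0 < η := by positivity
  -- Step 1: the thresholds
  obtain ⟨w₁, N₁, h1⟩ := exists_sum_abs_vonMangoldtW_sub_one_le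
  obtain ⟨w₂, N₂, h2⟩ := hSharp (η / C) (by positivity)
  obtain ⟨w₃, N₃, h3⟩ := hFlat (Fintype.card (Finset (Fin (s + 1)))) Kmax (η / 2 ^ (s + 1))
    (by positivity)
  obtain ⟨N₄, h4⟩ := exists_sum_primePowers_le hη0
  obtain ⟨N₅, h5⟩ := Filter.eventually_atTop.mp hR
  refine ⟨max w₁ (max w₂ w₃), max (max N₁ (max N₂ N₃)) (max (max N₄ N₅) 1), ?_⟩
  intro N hN w hw hwlog b hb1 hbW hbcop g x F hF
  have hNa := le_of_max_le_left hN
  have hNb := le_of_max_le_right hN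
  have hN₁ : N₁ ≤ N := le_of_max_le_left hNa
  have hN₂ : N₂ ≤ N := le_of_max_le_left (le_of_max_le_right hNa)
  have hN₃ : N₃ ≤ N := le_of_max_le_right (le_of_max_le_right hNa)
  have hN₄ : N₄ ≤ N := le_of_max_le_left (le_of_max_le_left hNb)
  have hN₅ : N₅ ≤ N := le_of_max_le_right (le_of_max_le_left hNb)
  have hN1 : 1 ≤ N := le_of_max_le_right hNb
  have hw₁ : w₁ ≤ w := le_of_max_le_left hw
  have hw₂ : w₂ ≤ w := le_of_max_le_left (le_of_max_le_right hw)
  have hw₃ : w₃ ≤ w := le_of_max_le_right (le_of_max_le_right hw)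
  have hNpos : (0 : ℝ) < N := by exact_mod_cast hN1
  have hlogR : Real.log (R N) ≠ 0 := h5 N hN₅
  -- Step 2: the net function and the approximating sequences along the orbit
  obtain ⟨i, hi⟩ := hnet F hF
  set a : ℤ → ℝ := fun m' => F (g ^ m' • x) with ha
  set bb : Fin (n i) → Finset (Fin (s + 1)) → ℤ → ℝ := fun j ω m' => B i j ω (g ^ m' • x) with hbb
  have hb1' : ∀ j ω m', |bb j ω m'| ≤ 1 := fun j ω m' => (hBL i j ω).1 _
  have hb0' : ∀ j m', bb j ∅ m' = 1 := fun j m' => hB0 i j _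
  have happrox : ∀ (m' : ℤ) (h : Fin (s + 1) → ℤ), 1 ≤ m' → m' ≤ N → (∀ j, 1 ≤ h j) →
      |a m' - ∑ j, c i j * ∏ ω : Finset (Fin (s + 1)), bb j ω (m' + ∑ l ∈ ω, h l)| ≤ ε / 6 := by
    intro m' h _ _ _
    have e1 := hBapp i g x m' h
    have e2 := hi (g ^ m' • x)
    change |F (g ^ m' • x) -
        ∑ j, c i j * ∏ ω : Finset (Fin (s + 1)), B i j ω (g ^ (m' + ∑ l ∈ ω, h l) • x)| ≤ ε / 6
    rw [show F (g ^ m' • x) -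
        ∑ j, c i j * ∏ ω : Finset (Fin (s + 1)), B i j ω (g ^ (m' + ∑ l ∈ ω, h l) • x) =
        (F (g ^ m' • x) - Fnet i (g ^ m' • x)) + (Fnet i (g ^ m' • x) -
          ∑ j, c i j * ∏ ω : Finset (Fin (s + 1)), B i j ω (g ^ (m' + ∑ l ∈ ω, h l) • x)) by ring]
    calc _ ≤ |F (g ^ m' • x) - Fnet i (g ^ m' • x)| + |Fnet i (g ^ m' • x) -
          ∑ j, c i j * ∏ ω : Finset (Fin (s + 1)), B i j ω (g ^ (m' + ∑ l ∈ ω, h l) • x)| :=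
          abs_add_le _ _
      _ ≤ ε / 12 + ε / 12 := add_le_add e2 e1
      _ = ε / 6 := by ring
  -- the weight and its three pieces
  set f : ℤ → ℝ := fun m' => vonMangoldtW (primorial w) b m'.toNat - 1 with hf
  set f₁ : ℤ → ℝ := fun m' => vonMangoldtW (primorial w) b m'.toNat - vonMangoldtFullW (primorial w) b m'.toNat with hf₁
  set f₂ : ℤ → ℝ := fun m' => vonMangoldtSmoothW χ (R N) (primorial w) b m'.toNat - 1 with hf₂
  set f₃ : ℤ → ℝ := fun m' => vonMangoldtSmoothW (flatCutoff χ) (R N) (primorial w) b m'.toNat with hf₃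
  have hfsplit : f = fun m' => f₁ m' + (f₂ m' + f₃ m') := by
    funext m'
    simp only [hf, hf₁, hf₂, hf₃]
    have := vonMangoldtSmoothW_add_flat hlogR χ (primorial w) b m'.toNat
    linarith
  -- Step 3: averaging over the window shifts and the approximation
  have hstep := abs_pow_mul_sum_sub_sum_cubeSum_le (k := s + 1) a (c i) bb happrox f
  have hfL1 : ∑ m' ∈ Icc (1 : ℤ) N, |f m'| ≤ 3 * N := by
    rw [sum_Icc_int_eq_sum_Icc_toNat le_rfl]
    have e : ((N : ℤ)).toNat = N := Int.toNat_natCast N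
    rw [Int.toNat_one, e]
    have h := h1 N hN₁ w hw₁ hwlog b hb1 hbW hbcop
    refine le_trans (le_of_eq (Finset.sum_congr rfl fun n' _ => ?_)) h
    simp only [hf, Int.toNat_natCast]
  -- Step 4: the three pieces of each window-averaged cube sum
  have hT₁ : ∀ j, |cubeSum N f₁ (bb j)| ≤ (N : ℝ) ^ (s + 1) * (η * N) := by
    intro j
    refine (abs_cubeSum_le_sum_abs N f₁ (bb j) (hb1' j)).trans ?_
    refine mul_le_mul_of_nonneg_left ?_ (by positivity)
    rw [sum_Icc_int_eq_sum_Icc_toNat le_rfl]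
    have e : ((N : ℤ)).toNat = N := Int.toNat_natCast N
    rw [Int.toNat_one, e]
    have h := h4 N hN₄ w hwlog b hb1 hbW
    refine le_trans (le_of_eq (Finset.sum_congr rfl fun n' _ => ?_)) h
    simp only [hf₁, Int.toNat_natCast]
    rw [abs_sub_comm, abs_of_nonneg (sub_nonneg.mpr (vonMangoldtW_le_vonMangoldtFullW (primorial w) b n'))]
  have hT₂ : ∀ j, |cubeSum N f₂ (bb j)| ≤ C * N * (N : ℝ) ^ (s + 1) * (η / C) := by
    intro j
    have h := abs_cubeSum_le_uniformityNorm (k := s + 1) (Nat.succ_pos s) hN1 f₂ (bb j)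
      (fun ω m' _ => hb1' j ω m') (hb0' j)
    simp only [Nat.cast_add, Nat.cast_one] at h
    rw [← hC] at h
    have hU : uniformityNorm (s + 1) N (fun n' => ((f₂ n' : ℝ) : ℂ)) ≤ η / C :=
      h2 N hN₂ w hw₂ hwlog b hb1 hbW hbcop
    exact h.trans (mul_le_mul_of_nonneg_left hU (by positivity))
  have hT₃ : ∀ j, |cubeSum N f₃ (bb j)| ≤
      ((shiftBox (s + 1) N).card : ℝ) * (η / 2 ^ (s + 1) * N) := by
    intro j
    rw [cubeSum_eq_sum_window]
    refine (Finset.abs_sum_le_sum_abs _ _).trans ?_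
    have hterm : ∀ h ∈ shiftBox (s + 1) N,
        |∑ n' ∈ Icc (windowLo N h) (windowHi N h),
            f₃ n' * ∏ ω : Finset (Fin (s + 1)), bb j ω (n' + ∑ l ∈ ω, h l)| ≤
          η / 2 ^ (s + 1) * N := by
      intro h _
      set e := Fintype.equivFin (Finset (Fin (s + 1))) with he
      set y : Finset (Fin (s + 1)) → X.G ⧸ X.Γ := fun ω => g ^ (∑ l ∈ ω, h l) • x with hy
      set H' : Fin (Fintype.card (Finset (Fin (s + 1)))) → X.G ⧸ X.Γ → ℝ :=
        fun q => B i j (e.symm q) with hH'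
      have hH'L : ∀ q, X.IsBoundedLipschitz Kmax (H' q) := fun q => (hBL i j _).mono (hKle i)
      have hlo : 1 ≤ (windowLo N h).toNat := by have := one_le_windowLo N h; omega
      have hhi : (windowHi N h).toNat ≤ N := by have := windowHi_le N h; omega
      have hflat := h3 N hN₃ w hw₃ hwlog b hb1 hbW hbcop H' hH'L g (fun q => y (e.symm q))
        (windowLo N h).toNat (windowHi N h).toNat hlo hhi
      rw [sum_Icc_int_eq_sum_Icc_toNat (one_le_windowLo N h)]
      refine le_trans (le_of_eq ?_) hflat
      congr 1
      refine Finset.sum_congr rfl fun n' _ => ?_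
      simp only [hf₃, Int.toNat_natCast]
      congr 1
      exact (Fintype.prod_equiv e.symm _ _ fun q => by
        simp only [hH', hbb, hy, zpow_add, zpow_natCast, mul_smul]).symm
    calc ∑ h ∈ shiftBox (s + 1) N, |∑ n' ∈ Icc (windowLo N h) (windowHi N h),
            f₃ n' * ∏ ω : Finset (Fin (s + 1)), bb j ω (n' + ∑ l ∈ ω, h l)|
        ≤ ∑ h ∈ shiftBox (s + 1) N, (η / 2 ^ (s + 1) * N) := Finset.sum_le_sum hterm
      _ = ((shiftBox (s + 1) N).card : ℝ) * (η / 2 ^ (s + 1) * N) := by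
          rw [Finset.sum_const, nsmul_eq_mul]
  -- Step 5: combination
  have hNk : (0 : ℝ) < (N : ℝ) ^ (s + 1) := by positivity
  have hcard : ((shiftBox (s + 1) N).card : ℝ) * (η / 2 ^ (s + 1) * N) =
      η * ((N : ℝ) ^ (s + 1) * N) := by
    rw [card_shiftBox]
    push_cast
    rw [mul_pow]
    field_simp
  have hTj : ∀ j, |cubeSum N f (bb j)| ≤ 3 * η * ((N : ℝ) ^ (s + 1) * N) := by
    intro j
    have e : cubeSum N f (bb j) =
        cubeSum N f₁ (bb j) + (cubeSum N f₂ (bb j) + cubeSum N f₃ (bb j)) := by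
      rw [hfsplit, cubeSum_add, cubeSum_add]
    have h12 : |cubeSum N f₁ (bb j) + (cubeSum N f₂ (bb j) + cubeSum N f₃ (bb j))| ≤
        |cubeSum N f₁ (bb j)| + |cubeSum N f₂ (bb j) + cubeSum N f₃ (bb j)| := abs_add_le _ _
    have h23 : |cubeSum N f₂ (bb j) + cubeSum N f₃ (bb j)| ≤
        |cubeSum N f₂ (bb j)| + |cubeSum N f₃ (bb j)| := abs_add_le _ _
    have hC2 : C * N * (N : ℝ) ^ (s + 1) * (η / C) = η * ((N : ℝ) ^ (s + 1) * N) := by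
      field_simp
    have hN2 : (N : ℝ) ^ (s + 1) * (η * N) = η * ((N : ℝ) ^ (s + 1) * N) := by ring
    rw [e]
    linarith [h12, h23, hT₁ j, hT₂ j, hT₃ j, hcard, hC2, hN2]
  have hLi : ∑ j, |c i j| ≤ L + 1 := by
    have : ∑ j, |c i j| ≤ L := Finset.single_le_sum (f := fun i => ∑ j, |c i j|)
      (fun i _ => Finset.sum_nonneg fun j _ => abs_nonneg _) (Finset.mem_univ i)
    linarith
  have hMain : |∑ j, c i j * cubeSum N f (bb j)| ≤ ε / 2 * ((N : ℝ) ^ (s + 1) * N) := by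
    calc |∑ j, c i j * cubeSum N f (bb j)| ≤ ∑ j, |c i j| * |cubeSum N f (bb j)| := by
          refine (Finset.abs_sum_le_sum_abs _ _).trans (le_of_eq (Finset.sum_congr rfl fun j _ => ?_))
          rw [abs_mul]
      _ ≤ ∑ j, |c i j| * (3 * η * ((N : ℝ) ^ (s + 1) * N)) :=
          Finset.sum_le_sum fun j _ => mul_le_mul_of_nonneg_left (hTj j) (abs_nonneg _)
      _ = (∑ j, |c i j|) * (3 * η * ((N : ℝ) ^ (s + 1) * N)) := by rw [Finset.sum_mul]
      _ ≤ (L + 1) * (3 * η * ((N : ℝ) ^ (s + 1) * N)) :=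
          mul_le_mul_of_nonneg_right hLi (by positivity)
      _ = ε / 2 * ((N : ℝ) ^ (s + 1) * N) := by
          rw [hη]
          field_simp
          ring
  have hE : |(N : ℝ) ^ (s + 1) * ∑ m' ∈ Icc (1 : ℤ) N, f m' * a m' -
      ∑ j, c i j * cubeSum N f (bb j)| ≤ ε / 2 * ((N : ℝ) ^ (s + 1) * N) := by
    refine hstep.trans ?_
    calc ε / 6 * ((N : ℝ) ^ (s + 1) * ∑ m' ∈ Icc (1 : ℤ) N, |f m'|)
        ≤ ε / 6 * ((N : ℝ) ^ (s + 1) * (3 * N)) :=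
          mul_le_mul_of_nonneg_left (mul_le_mul_of_nonneg_left hfL1 hNk.le) (by positivity)
      _ = ε / 2 * ((N : ℝ) ^ (s + 1) * N) := by ring
  have hkey : (N : ℝ) ^ (s + 1) * |∑ m' ∈ Icc (1 : ℤ) N, f m' * a m'| ≤
      (N : ℝ) ^ (s + 1) * (ε * N) := by
    have h := abs_sub_abs_le_abs_sub ((N : ℝ) ^ (s + 1) * ∑ m' ∈ Icc (1 : ℤ) N, f m' * a m')
      (∑ j, c i j * cubeSum N f (bb j))
    rw [abs_mul, abs_of_pos hNk] at h
    linarith [hMain, hE, h]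
  have hkey2 : |∑ m' ∈ Icc (1 : ℤ) N, f m' * a m'| ≤ ε * N := le_of_mul_le_mul_left hkey hNk
  -- Step 6: back to the orbit average over `[N] ⊆ ℕ`
  unfold Nilmanifold.orbitAverage
  rw [abs_div, abs_of_pos hNpos, div_le_iff₀ hNpos]
  have hsumZ : ∑ m' ∈ Icc (1 : ℤ) N, f m' * a m' =
      ∑ n' ∈ Finset.Icc 1 N, (vonMangoldtW (primorial w) b n' - 1) * F (g ^ n' • x) := by
    rw [sum_Icc_int_eq_sum_Icc_toNat le_rfl]
    have e : ((N : ℤ)).toNat = N := Int.toNat_natCast N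
    rw [Int.toNat_one, e]
    refine Finset.sum_congr rfl fun n' _ => ?_
    simp only [hf, ha, Int.toNat_natCast, zpow_natCast]
  rw [← hsumZ]
  exact hkey2

/-! ### What Thm. 7.2 now rests on -/

/-- **Thm. 7.2 at level `s` from a rational `GI(s)` datum, the sharp Gowers estimate (12.6) and
the flat orthogonality (12.7) for rational nilmanifolds** (Prop. 6.4, Prop. 10.1 ⇐ `GI(s)` +
Cor. 11.6, Cor. 11.6, and now Prop. 10.2 ⇐ (12.6) + (12.7) being theorems of the tree; Prop. 10.2
is only needed for the finitely many members of the family, at the Lipschitz constant of the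
datum). [cite: GreenTao2010, Thm. 7.2, §10 (proof of Thm. 7.2), §§11–12] -/
theorem GreenTao2010_gowersUniformityAt_of_rationalDatum_of_sharp_of_flat {s : ℕ} (hs : 1 ≤ s)
    (hGI : ∀ δ : ℝ, 0 < δ → δ ≤ 1 → ∃ (m : ℕ) (𝓜 : Fin m → Nilmanifold s) (MG cG : ℝ),
      (∀ i, (𝓜 i).IsRational) ∧ GreenTao2010_inverseDatum s δ 𝓜 MG cG)
    (χ : ℝ → ℝ) (R : ℕ → ℝ) (hR : ∀ᶠ N : ℕ in atTop, Real.log (R N) ≠ 0)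
    (hSharp : GreenTao2010_sharpUniformAt s χ R)
    (hFlat : ∀ X : Nilmanifold s, X.IsRational → GreenTao2010_flatOrthogonalAt s X χ R) :
    GreenTao2010_gowersUniformityAt s := by
  refine GreenTao2010_gowersUniformityAt_of_local hs GreenTao2010_pseudorandomDomination_holds
    fun δ hδ hδ1 C hC A => ?_
  have hC1 : (1 : ℝ) ≤ C := by linarith
  obtain ⟨m, 𝓜, MG, cG, hrat, hd⟩ := hGI (relInvParam s C δ) (relInvParam_pos s (by linarith) hδ)
    (relInvParam_le_one s hC1 hδ1)
  obtain ⟨η, hdat⟩ := GreenTao2010_relativeInverseDatum_of_inverseDatum hs hδ hC A hd fun i =>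
    GreenTao2010_nilObstructionAt_of_isRational (𝓜 i) (hrat i) MG
  exact ⟨m, 𝓜, MG, cG / 2, η, 1, hdat, fun i =>
    GreenTao2010_nilsequenceOrthogonalityAt_of_sharp_of_flat (𝓜 i) (hrat i) MG χ R hR hSharp
      (hFlat _ (hrat i))⟩

/-- **`GreenTao2010_gowersUniformity` from Lemma E.9 (Mal'cev), `GI(s)` as printed, and, at each
level, some cutoff `χ♯` and level function `R` satisfying (12.6) and (12.7)** — with §§4–7, §10,
§11, the first half of §12 and Apps. A–E of the paper now theorems of the tree, Thm. 7.2 rests on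
`GI(s)` [Green–Tao–Ziegler], the sharp estimate (12.6) [App. D with `a = 1`], the flat estimate
(12.7) [`MN(s)`, Green–Tao 2012, via the second half of §12] and Lemma E.9 [Mal'cev].
[cite: GreenTao2010, Thm. 7.2, §§10–12, Conj. 8.3, Conj. 8.5, App. D, App. E (Lemma E.9)] -/
theorem GreenTao2010_gowersUniformity_of_malcev_of_GI_of_sharp_of_flat
    (hE9 : ∀ (s : ℕ) (X : Nilmanifold s), X.IsRational)
    (hGI : ∀ s : ℕ, 1 ≤ s → ∀ δ : ℝ, 0 < δ → δ ≤ 1 → GreenTao2010_inverseConjectureAt s δ)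
    (hSF : ∀ s : ℕ, 1 ≤ s → ∃ (χ : ℝ → ℝ) (R : ℕ → ℝ), (∀ᶠ N : ℕ in atTop, Real.log (R N) ≠ 0) ∧
      GreenTao2010_sharpUniformAt s χ R ∧ ∀ X : Nilmanifold s, GreenTao2010_flatOrthogonalAt s X χ R) :
    GreenTao2010_gowersUniformity :=
  GreenTao2010_gowersUniformity_of_malcev_of_GI_of_orthogonality hE9 hGI fun s hs X M => by
    obtain ⟨χ, R, hR, hS, hF⟩ := hSF s hs
    exact GreenTao2010_nilsequenceOrthogonalityAt_of_sharp_of_flat X (hE9 s X) M χ R hR hS (hF X)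

/-- **The Green–Tao–Ziegler theorem from Lemma E.9, `GI(s)`, (12.6) and (12.7).**
[cite: GreenTao2010, Main Theorem, §§10–12] [cite: GreenTaoZiegler2012, Thm. 1.3] -/
theorem GreenTaoZiegler2012_finiteComplexity_of_malcev_of_GI_of_sharp_of_flat
    (hE9 : ∀ (s : ℕ) (X : Nilmanifold s), X.IsRational)
    (hGI : ∀ s : ℕ, 1 ≤ s → ∀ δ : ℝ, 0 < δ → δ ≤ 1 → GreenTao2010_inverseConjectureAt s δ)
    (hSF : ∀ s : ℕ, 1 ≤ s → ∃ (χ : ℝ → ℝ) (R : ℕ → ℝ), (∀ᶠ N : ℕ in atTop, Real.log (R N) ≠ 0) ∧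
      GreenTao2010_sharpUniformAt s χ R ∧ ∀ X : Nilmanifold s, GreenTao2010_flatOrthogonalAt s X χ R) :
    GreenTaoZiegler2012_finiteComplexity :=
  GreenTaoZiegler2012_finiteComplexity_of_gowersUniformity
    (GreenTao2010_gowersUniformity_of_malcev_of_GI_of_sharp_of_flat hE9 hGI hSF)

end Literature.NumberTheory.Sieve
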